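import Mathlib.Analysis.Calculus.FDeriv.Prod
import Mathlib.Analysis.Calculus.FDeriv.Mul
import Mathlib.Analysis.Calculus.FDeriv.Add
import Mathlib.Analysis.SpecificLimits.Normed
import Literature.Barriers.CriticalPhenomena.WeaklySAWQuadraticFlowCutoff
import Literature.Barriers.CriticalPhenomena.WeaklySAWCouplingFlowCutoffDeriv
import HarnessLib

/-!
# [BBS-rg-flow, §4.1–§4.2]: the linearised quadratic flow `L_j = DΦ̄⁰_j(x̊_j)` and its solution
# operator `S̄` (Lemmas 4.1–4.3), componentwise; the derivative `Dφ̄_j` of the quadratic flow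

Sixth file of the series formalising [BBS-rg-flow] (Bauerschmidt–Brydges–Slade, AHP 16 (2015),
arXiv:1211.2477), the abstract dynamical-system input of BBS 2015, Theorem 4.1 (via its Theorem 7.2.1),
towards `Literature.Barriers.CriticalPhenomena.WeaklySAWFourDimLogCorrections`; continuation of
`WeaklySAWQuadraticFlowCutoff.lean` (the flow `x̊ = V̄ = (ḡ, z̄, μ̄) = P.flow g₀`, hypotheses
`CutoffQuadHyp`) and `WeaklySAWCouplingFlowCutoffDeriv.lean` (`∏(1 - 2β_lḡ_l) ≤ (ḡ_{i+n}/ḡ_i)²`).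

§4 of the source proves the key Lemma 3.5 (the solution operator `S(t,x)` of the linearised equation
`y_{j+1} - D_xΦ_j(t,x_j)y_j = r_j`) in three steps; this file is Steps 1–2, at the level of the
components of the sequences (the weighted Banach spaces `X^𝗐, X^𝗏` of §3.2 only repackage these
bounds and are introduced in a later file):
* §4.1, (4.2)–(4.4): the matrix `DΦ̄⁰_j(x_j)` and its value `L_j` at `x̊`. `QuadFlowParams.dmap j V`
  is `Dφ̄_j(V) : ℝ³ →L ℝ³` with `hasFDerivAt_map` (PROVED: `φ̄_j` is Fréchet differentiable with this
  derivative), its entries at `V̄_j` are `a_j = 1 - 2β_jg̊_j`, `-ξ̃_j`, `1 - ζ_jg̊_j`, `η̃_j`, `γ̃_j`,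
  `λ̃_j = λ_j - τ_j` (`aCoef`, `xiT`, `czCoef`, `etaT`, `gammaT`, `lamT`; `dmap_flow_apply`); `Dφ̄_j`
  is affine in the base point with coefficients `O(χ_j)` (`dmap_sub_dmap_apply`,
  `norm_dmap_sub_dmap_le`: "`D²Φ̄⁰_j` is a constant matrix with coefficients `O(χ_j)`", proof of
  Lemma 4.4), and the second-order Taylor formula of the quadratic map is EXACT
  (`map_add_sub_sub_dmap`, `norm_map_add_sub_sub_dmap_le`);
* Lemma 4.1: `∏ a_k ≤ (g̊_{l+n}/g̊_l)²` ((4.6)), `|ξ̃_j| ≤ C(2+Z)χ_jg̊_j`, `|η̃_j|, |γ̃_j| ≤ C'χ_j` ((4.7)),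
  `λ̃_j ≥ (1+λ)/2`, `0 ≤ ∏λ̃⁻¹ ≤ α^{l+1}`, `0 ≤ ∏(1-ζg̊)⁻¹ ≤ 2` ((4.8));
* Lemma 4.2, (4.10)–(4.11): the solution of `y_{j+1} = L_jy_j + r_j` with `u₀ = 0`, `v_∞ = 0`, as the
  explicit sequences `linG` (forward), `linZ`, `linMu` (backward series), with the recursions
  `g_{j+1} = a_jg_j + r^g_j`, `z_{j+1} = -ξ̃_jg_j + (1-ζ_jg̊_j)z_j + r^z_j`,
  `μ_{j+1} = η̃_jg_j + γ̃_jz_j + λ̃_jμ_j + r^μ_j` (`linG_succ`, `linZ_succ`, `linMu_succ`) and the final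
  conditions (`tendsto_linZ_linMu_zero`);
* Lemma 4.3, (4.13)–(4.18): for sources with `|r^α_l| ≤ Rχ_lg̊_l³` (`‖r‖_{X^𝗏} ≤ R`), the weighted
  bounds `|g_j| ≤ C_gR g̊_j²|log g̊_j|`, `|z_j| ≤ C_zR χ_jg̊_j²|log g̊_j|`, `|μ_j| ≤ C_μR χ_jg̊_j²|log g̊_j|`
  — the weights `𝗐` of (3.2) — with `C_g = 12C_{1,0}`, `C_z`, `C_μ` (`linGConst`, `linZConst`,
  `linMuConst`) depending only on `(Ω, c, N, C, λ)`: independent of the parameters `a, h` of `D_j`, of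
  the cut-off and of `g₀`, as printed ("`C_S̄` is independent of `a, h`"); packaged as `linSol_spec`.
  The `K`-row of `S̄` is the trivial shift `K_j = r^K_{j-1}` (`S̄ = diag(1, S̄_{VV})`, (4.13)) and is
  left to the Banach-space file.
Extra smallness used: `4g₀ ≤ e⁻¹` (so that `t|log t|` is monotone along the flow).

Deliberately NOT here: the spaces `X^𝗐, X^𝗏` and operator norms (§3.2), Lemma 3.3, Step 3 (Lemmas
4.4–4.5 and Lemma 3.5), the `K`-component.

## References
* R. Bauerschmidt, D. C. Brydges, G. Slade, *Structural stability of a dynamical system near a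
  non-hyperbolic fixed point*, Ann. Henri Poincaré 16 (2015), arXiv:1211.2477: §4.1 (4.2)–(4.5),
  Lemma 4.1 (4.6)–(4.8), Lemma 4.2 (4.10)–(4.11), Lemma 4.3 (4.13)–(4.18), Remark 3.2, Lemma 4.4
  (proof). [BauerschmidtBrydgesSlade2015Flow]
-/

noncomputable section

open Filter Topology Set
open scoped BigOperators

namespace Literature.Barriers.CriticalPhenomena

namespace CTWSAW

/-! ## [BBS-rg-flow, §4.1–§4.2]: the linearised quadratic flow `L_j = DΦ̄⁰_j(x̊_j)` and its solution
operator `S̄` with the boundary conditions `u₀ = 0`, `v_∞ = 0` (Lemmas 4.1–4.3), componentwise -/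

namespace QuadFlowParams

variable (P : QuadFlowParams) (g₀ : ℝ)

/-- `a_j = 1 - 2β_jg̊_j`, the `gg`-entry of `A_j` ((4.4)): the propagator of the `g`-component.
[cite: BauerschmidtBrydgesSlade2015Flow, §4.1, (4.2) and (4.4)] -/
def aCoef (j : ℕ) : ℝ := 1 - 2 * P.β j * gbar P.β g₀ j

/-- `ξ̃_j = 2θ_jg̊_j + ζ_jz̊_j` at `x̊ = V̄` ((4.3)). [cite: BauerschmidtBrydgesSlade2015Flow, §4.1, (4.3)] -/
def xiT (j : ℕ) : ℝ := 2 * P.θ j * gbar P.β g₀ j + P.ζ j * P.zbar g₀ j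

/-- `1 - ζ_jg̊_j`, the `zz`-entry of `C_j` ((4.4)). [cite: BauerschmidtBrydgesSlade2015Flow, §4.1, (4.2) and (4.4)] -/
def czCoef (j : ℕ) : ℝ := 1 - P.ζ j * gbar P.β g₀ j

/-- `η̃_j = η_j - 2υ^{gg}_jg̊_j - υ^{gz}_jz̊_j - υ^{gμ}_jμ̊_j` at `x̊ = V̄` ((4.3)). [cite: BauerschmidtBrydgesSlade2015Flow, §4.1, (4.3)] -/
def etaT (j : ℕ) : ℝ := P.η j - 2 * P.υgg j * gbar P.β g₀ j - P.υgz j * P.zbar g₀ j - P.υgμ j * P.mubar g₀ j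

/-- `γ̃_j = γ_j - υ^{gz}_jg̊_j - 2υ^{zz}_jz̊_j - υ^{zμ}_jμ̊_j` at `x̊ = V̄` ((4.3)). [cite: BauerschmidtBrydgesSlade2015Flow, §4.1, (4.3)] -/
def gammaT (j : ℕ) : ℝ :=
  P.γ j - P.υgz j * gbar P.β g₀ j - 2 * P.υzz j * P.zbar g₀ j - P.υzμ j * P.mubar g₀ j

/-- `λ̃_j = λ_j - υ^{gμ}_jg̊_j - υ^{zμ}_jz̊_j = λ_j - τ_j` at `x̊ = V̄` ((4.3)). [cite: BauerschmidtBrydgesSlade2015Flow, §4.1, (4.3)] -/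
def lamT (j : ℕ) : ℝ := P.lam j - P.υgμ j * gbar P.β g₀ j - P.υzμ j * P.zbar g₀ j

/-- `λ̃_j = λ_j - τ_j`. [cite: BauerschmidtBrydgesSlade2015Flow, §4.1, (4.3) and Lemma 2.2, (2.16)] -/
theorem lamT_eq (j : ℕ) : P.lamT g₀ j = P.lam j - P.tau g₀ j := by
  simp only [lamT, tau]; ring

/-- The `g`-component of the solution of `y_{j+1} = L_jy_j + r_j` with `u₀ = 0`:
`g₀ = 0`, `g_{j+1} = a_jg_j + r^g_j` (so `g_j = Σ_{l<j} A_{j-1}⋯A_{l+1}r^g_l`, (4.10)).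
[cite: BauerschmidtBrydgesSlade2015Flow, Lemma 4.2, (4.10)] -/
def linG (rg : ℕ → ℝ) : ℕ → ℝ
  | 0 => 0
  | j + 1 => P.aCoef g₀ j * linG rg j + rg j

/-- `∏_{i=j}^{j+l} (1 - ζ_ig̊_i)⁻¹`, the `zz`-entry of `C_j⁻¹⋯C_{j+l}⁻¹`. [cite: BauerschmidtBrydgesSlade2015Flow, Lemma 4.1(iii) (τ̄_{j,l})] -/
def czInvProd (j l : ℕ) : ℝ := ∏ i ∈ Finset.range (l + 1), (P.czCoef g₀ (i + j))⁻¹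

/-- `∏_{i=j}^{j+l} λ̃_i⁻¹`, the `μμ`-entry of `C_j⁻¹⋯C_{j+l}⁻¹`. [cite: BauerschmidtBrydgesSlade2015Flow, Lemma 4.1(iii) (ᾱ_{j,l})] -/
def lamTInvProd (j l : ℕ) : ℝ := ∏ i ∈ Finset.range (l + 1), (P.lamT g₀ (i + j))⁻¹

/-- The `z`-component of the solution with `v_∞ = 0`: the `z`-row of (4.11),
`z_j = -Σ_{l≥j} ∏_{i=j}^l(1 - ζ_ig̊_i)⁻¹ (-ξ̃_lg_l + r^z_l)`. [cite: BauerschmidtBrydgesSlade2015Flow, Lemma 4.2, (4.11)] -/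
def linZ (rg rz : ℕ → ℝ) (j : ℕ) : ℝ :=
  -∑' l, P.czInvProd g₀ j l * (-P.xiT g₀ (l + j) * P.linG g₀ rg (l + j) + rz (l + j))

/-- The `μ`-component of the solution with `v_∞ = 0`: the `μ`-row of (4.11),
`μ_j = -Σ_{l≥j} ∏_{i=j}^l λ̃_i⁻¹ (η̃_lg_l + γ̃_lz_l + r^μ_l)`. [cite: BauerschmidtBrydgesSlade2015Flow, Lemma 4.2, (4.11)] -/
def linMu (rg rz rμ : ℕ → ℝ) (j : ℕ) : ℝ :=
  -∑' l, P.lamTInvProd g₀ j l *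
    (P.etaT g₀ (l + j) * P.linG g₀ rg (l + j) + P.gammaT g₀ (l + j) * P.linZ g₀ rg rz (l + j) + rμ (l + j))

/-- `g₀ = 0` (the boundary condition `π_u y₀ = 0`). [cite: BauerschmidtBrydgesSlade2015Flow, Lemma 4.2 (u₀ = 0)] -/
@[simp] theorem linG_zero (rg : ℕ → ℝ) : P.linG g₀ rg 0 = 0 := rfl

/-- `g_{j+1} = a_jg_j + r^g_j`. [cite: BauerschmidtBrydgesSlade2015Flow, Lemma 4.2 (proof: u_{j+1} = A_ju_j + π_ur_j)] -/
theorem linG_succ (rg : ℕ → ℝ) (j : ℕ) : P.linG g₀ rg (j + 1) = P.aCoef g₀ j * P.linG g₀ rg j + rg j := rfl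

/-- `czInvProd j 0 = (1 - ζ_jg̊_j)⁻¹`. [cite: BauerschmidtBrydgesSlade2015Flow, Lemma 4.1(iii)] -/
theorem czInvProd_zero (j : ℕ) : P.czInvProd g₀ j 0 = (P.czCoef g₀ j)⁻¹ := by simp [czInvProd]

/-- `czInvProd j (l+1) = (1 - ζ_jg̊_j)⁻¹ czInvProd (j+1) l`. [cite: BauerschmidtBrydgesSlade2015Flow, Lemma 4.1(iii)] -/
theorem czInvProd_succ (j l : ℕ) :
    P.czInvProd g₀ j (l + 1) = (P.czCoef g₀ j)⁻¹ * P.czInvProd g₀ (j + 1) l := by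
  unfold czInvProd
  rw [Finset.prod_range_succ' _ (l + 1), zero_add, mul_comm]
  congr 1
  exact Finset.prod_congr rfl fun i _ => by rw [Nat.add_right_comm, Nat.add_assoc]

/-- `czInvProd` as a product over `[j, j+l]`. [cite: BauerschmidtBrydgesSlade2015Flow, Lemma 4.1(iii)] -/
theorem czInvProd_eq_prod_Icc (j l : ℕ) :
    P.czInvProd g₀ j l = ∏ m ∈ Finset.Icc j (j + l), (1 - P.ζ m * gbar P.β g₀ m)⁻¹ := by
  unfold czInvProd czCoef
  rw [Finset.range_eq_Ico, Finset.prod_Ico_add' (fun m => (1 - P.ζ m * gbar P.β g₀ m)⁻¹), zero_add,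
    show l + 1 + j = j + l + 1 by ring, Finset.Ico_add_one_right_eq_Icc]

/-- `lamTInvProd j 0 = λ̃_j⁻¹`. [cite: BauerschmidtBrydgesSlade2015Flow, Lemma 4.1(iii)] -/
theorem lamTInvProd_zero (j : ℕ) : P.lamTInvProd g₀ j 0 = (P.lamT g₀ j)⁻¹ := by simp [lamTInvProd]

/-- `lamTInvProd j (l+1) = λ̃_j⁻¹ lamTInvProd (j+1) l`. [cite: BauerschmidtBrydgesSlade2015Flow, Lemma 4.1(iii)] -/
theorem lamTInvProd_succ (j l : ℕ) :
    P.lamTInvProd g₀ j (l + 1) = (P.lamT g₀ j)⁻¹ * P.lamTInvProd g₀ (j + 1) l := by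
  unfold lamTInvProd
  rw [Finset.prod_range_succ' _ (l + 1), zero_add, mul_comm]
  congr 1
  exact Finset.prod_congr rfl fun i _ => by rw [Nat.add_right_comm, Nat.add_assoc]

end QuadFlowParams

/-! ### Lemma 4.1: the blocks `A_j`, `B_j`, `C_j` — bounds on the coefficients -/

namespace CutoffQuadHyp

variable {P : QuadFlowParams} {Ω : ℝ} {k : ℕ∞} {B c : ℝ} {N : ℕ} {C lam g₀ : ℝ}
  (h : CutoffQuadHyp P Ω k B c N C lam g₀)
include h

/-- `0 ≤ a_j = 1 - 2β_jg̊_j ≤ 2`. [cite: BauerschmidtBrydgesSlade2015Flow, Lemma 4.1(i)] -/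
theorem aCoef_mem (j : ℕ) : P.aCoef g₀ j ∈ Set.Icc (0 : ℝ) 2 := by
  have := h.abs_beta_mul_gbar_le_half j
  have hg := (h.gbar_pos j).le
  have : |P.β j * gbar P.β g₀ j| ≤ 1 / 2 := by rwa [abs_mul, abs_of_nonneg hg]
  unfold QuadFlowParams.aCoef
  constructor <;> nlinarith [le_abs_self (P.β j * gbar P.β g₀ j), neg_abs_le (P.β j * gbar P.β g₀ j)]

/-- **Lemma 4.1(i)**: `A_j⋯A_l = O(g̊_{j+1}²/g̊_l²)`, precisely `∏_{k=l}^{l+n-1} a_k ≤ (g̊_{l+n}/g̊_l)²`.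
[cite: BauerschmidtBrydgesSlade2015Flow, Lemma 4.1(i), (4.6)] -/
theorem prod_aCoef_le (l n : ℕ) :
    ∏ i ∈ Finset.range n, P.aCoef g₀ (l + i) ≤ (gbar P.β g₀ (l + n) / gbar P.β g₀ l) ^ 2 :=
  h.toCutoffGbarHyp.prod_one_sub_two_mul_le l n

/-- **Lemma 4.1(ii)**: `ξ̃_j = O(χ_jg̊_j)`, precisely `|ξ̃_j| ≤ C(2 + Z)Ω^{-(j-k)₊}g̊_j`, `Z = 2C·C_{2,0}`.
[cite: BauerschmidtBrydgesSlade2015Flow, Lemma 4.1(ii), (4.7)] -/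
theorem abs_xiT_le (j : ℕ) :
    |P.xiT g₀ j| ≤ C * (2 + 2 * C * ((1 + N) / c + N + 2 * Ω / (Ω - 1))) *
      (cutoffWeight Ω k j * gbar P.β g₀ j) := by
  have hC := h.C_nonneg
  have hw := (h.weight_pos j).le; have hw1 := h.weight_le_one j
  have hg := (h.gbar_pos j).le
  have hz := h.abs_zbar_le j
  set Z := 2 * C * ((1 + N) / c + N + 2 * Ω / (Ω - 1)) with hZ
  have hZ0 : 0 ≤ Z := h.Z_nonneg
  unfold QuadFlowParams.xiT
  calc |2 * P.θ j * gbar P.β g₀ j + P.ζ j * P.zbar g₀ j|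
      ≤ 2 * |P.θ j| * gbar P.β g₀ j + |P.ζ j| * |P.zbar g₀ j| := by
        refine (abs_add_le _ _).trans (le_of_eq ?_)
        rw [abs_mul, abs_mul, abs_two, abs_of_nonneg hg, abs_mul]
    _ ≤ 2 * (C * cutoffWeight Ω k j) * gbar P.β g₀ j + C * (Z * (cutoffWeight Ω k j * gbar P.β g₀ j)) := by
        refine add_le_add ?_ ?_
        · exact mul_le_mul_of_nonneg_right (mul_le_mul_of_nonneg_left (h.theta_le j) zero_le_two) hg
        · exact mul_le_mul ((h.zeta_le j).trans (mul_le_of_le_one_right hC hw1)) hz (abs_nonneg _) hC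
    _ = C * (2 + Z) * (cutoffWeight Ω k j * gbar P.β g₀ j) := by ring

end CutoffQuadHyp


namespace CutoffQuadHyp

variable {P : QuadFlowParams} {Ω : ℝ} {k : ℕ∞} {B c : ℝ} {N : ℕ} {C lam g₀ : ℝ}
  (h : CutoffQuadHyp P Ω k B c N C lam g₀)
include h

/-! ### Lemma 4.1(ii)–(iii): bounds on `η̃_j, γ̃_j, λ̃_j` and the products of `C_j⁻¹` -/

/-- The constant `M_μ = 4K_σ/(λ-1)` of `|μ̄_j| ≤ M_μχ_jḡ_j` is `≥ 0`. [cite: BauerschmidtBrydgesSlade2015Flow, Lemma 2.2, (2.21)] -/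
theorem Mmu_nonneg :
    0 ≤ 4 * (C * (3 + 3 * (2 * C * ((1 + N) / c + N + 2 * Ω / (Ω - 1))) +
      (2 * C * ((1 + N) / c + N + 2 * Ω / (Ω - 1))) ^ 2) / 2) / (lam - 1) := by
  have := h.Ksigma_nonneg; have := h.one_lt_lam
  exact div_nonneg (by positivity) (by linarith)

/-- `|μ̄_j| ≤ M_μ ḡ_j` (dropping the weight). [cite: BauerschmidtBrydgesSlade2015Flow, Lemma 2.2, (2.21)] -/
theorem abs_mubar_le' (j : ℕ) :
    |P.mubar g₀ j| ≤ 4 * (C * (3 + 3 * (2 * C * ((1 + N) / c + N + 2 * Ω / (Ω - 1))) +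
      (2 * C * ((1 + N) / c + N + 2 * Ω / (Ω - 1))) ^ 2) / 2) / (lam - 1) * gbar P.β g₀ j := by
  refine (h.abs_mubar_le j).trans (mul_le_mul_of_nonneg_left ?_ h.Mmu_nonneg)
  exact mul_le_of_le_one_left (h.gbar_pos j).le (h.weight_le_one j)

/-- **Lemma 4.1(ii)**: `η̃_j = O(χ_j)`, precisely `|η̃_j| ≤ C(2 + (Z + M_μ)/2) Ω^{-(j-k)₊}`.
[cite: BauerschmidtBrydgesSlade2015Flow, Lemma 4.1(ii), (4.7)] -/
theorem abs_etaT_le (j : ℕ) :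
    |P.etaT g₀ j| ≤ C * (2 + (2 * C * ((1 + N) / c + N + 2 * Ω / (Ω - 1)) +
      4 * (C * (3 + 3 * (2 * C * ((1 + N) / c + N + 2 * Ω / (Ω - 1))) +
        (2 * C * ((1 + N) / c + N + 2 * Ω / (Ω - 1))) ^ 2) / 2) / (lam - 1)) / 2) * cutoffWeight Ω k j := by
  have hC := h.C_nonneg
  have hw := (h.weight_pos j).le; have hw1 := h.weight_le_one j
  have hg := (h.gbar_pos j).le; have hg2 := h.gbar_le_half j
  set Z := 2 * C * ((1 + N) / c + N + 2 * Ω / (Ω - 1)) with hZ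
  set Mμ := 4 * (C * (3 + 3 * Z + Z ^ 2) / 2) / (lam - 1) with hMμ
  have hZ0 : 0 ≤ Z := h.Z_nonneg
  have hM0 : 0 ≤ Mμ := h.Mmu_nonneg
  have hz : |P.zbar g₀ j| ≤ Z * gbar P.β g₀ j := h.abs_zbar_le' j
  have hμ : |P.mubar g₀ j| ≤ Mμ * gbar P.β g₀ j := h.abs_mubar_le' j
  set w := cutoffWeight Ω k j
  set g := gbar P.β g₀ j
  unfold QuadFlowParams.etaT
  have t1 : |P.η j| ≤ C * w := h.eta_le j
  have t2 : |2 * P.υgg j * g| ≤ 2 * (C * w) * (1 / 2) := by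
    rw [abs_mul, abs_mul, abs_two, abs_of_nonneg hg]
    exact mul_le_mul (mul_le_mul_of_nonneg_left (h.υgg_le j) zero_le_two) hg2 hg (by positivity)
  have t3 : |P.υgz j * P.zbar g₀ j| ≤ C * w * (Z * (1 / 2)) := by
    rw [abs_mul]
    exact mul_le_mul (h.υgz_le j) (hz.trans (mul_le_mul_of_nonneg_left hg2 hZ0)) (abs_nonneg _)
      (by positivity)
  have t4 : |P.υgμ j * P.mubar g₀ j| ≤ C * w * (Mμ * (1 / 2)) := by
    rw [abs_mul]
    exact mul_le_mul (h.υgμ_le j) (hμ.trans (mul_le_mul_of_nonneg_left hg2 hM0)) (abs_nonneg _)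
      (by positivity)
  calc |P.η j - 2 * P.υgg j * g - P.υgz j * P.zbar g₀ j - P.υgμ j * P.mubar g₀ j|
      ≤ |P.η j| + |2 * P.υgg j * g| + |P.υgz j * P.zbar g₀ j| + |P.υgμ j * P.mubar g₀ j| :=
        (abs_sub _ _).trans (add_le_add ((abs_sub _ _).trans (add_le_add (abs_sub _ _) le_rfl)) le_rfl)
    _ ≤ C * w + 2 * (C * w) * (1 / 2) + C * w * (Z * (1 / 2)) + C * w * (Mμ * (1 / 2)) := by linarith
    _ = C * (2 + (Z + Mμ) / 2) * w := by ring

/-- **Lemma 4.1(ii)–(iii)**: `γ̃_j = O(χ_j)`, precisely `|γ̃_j| ≤ C(3/2 + Z + M_μ/2) Ω^{-(j-k)₊}`.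
[cite: BauerschmidtBrydgesSlade2015Flow, Lemma 4.1(iii) (proof: "γ̄_m ≤ O(χ_m)")] -/
theorem abs_gammaT_le (j : ℕ) :
    |P.gammaT g₀ j| ≤ C * (3 / 2 + 2 * C * ((1 + N) / c + N + 2 * Ω / (Ω - 1)) +
      4 * (C * (3 + 3 * (2 * C * ((1 + N) / c + N + 2 * Ω / (Ω - 1))) +
        (2 * C * ((1 + N) / c + N + 2 * Ω / (Ω - 1))) ^ 2) / 2) / (lam - 1) / 2) * cutoffWeight Ω k j := by
  have hC := h.C_nonneg
  have hw := (h.weight_pos j).le; have hw1 := h.weight_le_one j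
  have hg := (h.gbar_pos j).le; have hg2 := h.gbar_le_half j
  set Z := 2 * C * ((1 + N) / c + N + 2 * Ω / (Ω - 1)) with hZ
  set Mμ := 4 * (C * (3 + 3 * Z + Z ^ 2) / 2) / (lam - 1) with hMμ
  have hZ0 : 0 ≤ Z := h.Z_nonneg
  have hM0 : 0 ≤ Mμ := h.Mmu_nonneg
  have hz : |P.zbar g₀ j| ≤ Z * gbar P.β g₀ j := h.abs_zbar_le' j
  have hμ : |P.mubar g₀ j| ≤ Mμ * gbar P.β g₀ j := h.abs_mubar_le' j
  set w := cutoffWeight Ω k j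
  set g := gbar P.β g₀ j
  unfold QuadFlowParams.gammaT
  have t1 : |P.γ j| ≤ C * w := h.gamma_le j
  have t2 : |P.υgz j * g| ≤ C * w * (1 / 2) := by
    rw [abs_mul, abs_of_nonneg hg]; exact mul_le_mul (h.υgz_le j) hg2 hg (by positivity)
  have t3 : |2 * P.υzz j * P.zbar g₀ j| ≤ 2 * (C * w) * (Z * (1 / 2)) := by
    rw [abs_mul, abs_mul, abs_two]
    exact mul_le_mul (mul_le_mul_of_nonneg_left (h.υzz_le j) zero_le_two)
      (hz.trans (mul_le_mul_of_nonneg_left hg2 hZ0)) (abs_nonneg _) (by positivity)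
  have t4 : |P.υzμ j * P.mubar g₀ j| ≤ C * w * (Mμ * (1 / 2)) := by
    rw [abs_mul]
    exact mul_le_mul (h.υzμ_le j) (hμ.trans (mul_le_mul_of_nonneg_left hg2 hM0)) (abs_nonneg _)
      (by positivity)
  calc |P.γ j - P.υgz j * g - 2 * P.υzz j * P.zbar g₀ j - P.υzμ j * P.mubar g₀ j|
      ≤ |P.γ j| + |P.υgz j * g| + |2 * P.υzz j * P.zbar g₀ j| + |P.υzμ j * P.mubar g₀ j| :=
        (abs_sub _ _).trans (add_le_add ((abs_sub _ _).trans (add_le_add (abs_sub _ _) le_rfl)) le_rfl)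
    _ ≤ C * w + C * w * (1 / 2) + 2 * (C * w) * (Z * (1 / 2)) + C * w * (Mμ * (1 / 2)) := by linarith
    _ = C * (3 / 2 + Z + Mμ / 2) * w := by ring

/-- **Lemma 4.1(iii)**: `λ̃_j ≥ (1+λ)/2`, so `0 ≤ λ̃_j⁻¹ ≤ α = 2/(1+λ) < 1`.
[cite: BauerschmidtBrydgesSlade2015Flow, Lemma 4.1(iii) (ᾱ_m < α)] -/
theorem lamT_ge (j : ℕ) : (1 + lam) / 2 ≤ P.lamT g₀ j := by
  rw [P.lamT_eq]; exact h.lam_sub_tau_ge j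

/-- `0 ≤ ∏_{i=j}^{j+l} λ̃_i⁻¹ ≤ α^{l+1}`. [cite: BauerschmidtBrydgesSlade2015Flow, Lemma 4.1(iii), (4.8) (ᾱ_{j,l} ≤ O(α^{l-j+1}))] -/
theorem lamTInvProd_mem (j l : ℕ) : P.lamTInvProd g₀ j l ∈ Set.Icc (0 : ℝ) ((2 / (1 + lam)) ^ (l + 1)) := by
  unfold QuadFlowParams.lamTInvProd
  simp only [P.lamT_eq]
  exact h.lamInvProd_mem j l

/-- `0 ≤ ∏_{i=j}^{j+l}(1 - ζ_ig̊_i)⁻¹ ≤ 2`. [cite: BauerschmidtBrydgesSlade2015Flow, Lemma 4.1(iii), (4.8) (τ̄_{j,l} = O(1))] -/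
theorem czInvProd_mem (j l : ℕ) : P.czInvProd g₀ j l ∈ Set.Icc (0 : ℝ) 2 := by
  rw [P.czInvProd_eq_prod_Icc, ← P.zetaInvProd_eq_prod_Icc]
  exact h.zetaInvProd_mem j l

/-- `1/2 ≤ 1 - ζ_jg̊_j ≤ 3/2`. [cite: BauerschmidtBrydgesSlade2015Flow, Lemma 4.1(iii)] -/
theorem czCoef_mem (j : ℕ) : P.czCoef g₀ j ∈ Set.Icc (1 / 2 : ℝ) (3 / 2) :=
  h.one_sub_zeta_mul_gbar_mem h.zeta_le h.smallC1 j

/-! ### Lemma 4.3, `g`-component: `|g_j| ≤ 12C_{1,0} R g̊_j²|log g̊_j|` for `|r^g_l| ≤ Rχ_lg̊_l³` -/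

omit h in
/-- `a_jg̊_j² ≤ g̊_{j+1}²` (`1 - 2x ≤ (1-x)²`). [cite: BauerschmidtBrydgesSlade2015Flow, Lemma 4.1(i)] -/
theorem aCoef_mul_sq_le (j : ℕ) : P.aCoef g₀ j * gbar P.β g₀ j ^ 2 ≤ gbar P.β g₀ (j + 1) ^ 2 := by
  rw [gbar_succ']
  unfold QuadFlowParams.aCoef
  nlinarith [sq_nonneg (P.β j * gbar P.β g₀ j), sq_nonneg (gbar P.β g₀ j),
    mul_nonneg (sq_nonneg (P.β j * gbar P.β g₀ j)) (sq_nonneg (gbar P.β g₀ j))]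

/-- The induction behind (4.15): if `|r^g_l| ≤ RΩ^{-(l-k)₊}g̊_l³` then
`|g_j| ≤ 4R g̊_j² Σ_{l<j} Ω^{-(l-k)₊}g̊_l`. [cite: BauerschmidtBrydgesSlade2015Flow, Lemma 4.3 (proof, (4.15)) and Remark 3.2] -/
theorem abs_linG_le_sum {rg : ℕ → ℝ} {R : ℝ} (hR : 0 ≤ R)
    (hrg : ∀ l, |rg l| ≤ R * (cutoffWeight Ω k l * gbar P.β g₀ l ^ 3)) (j : ℕ) :
    |P.linG g₀ rg j| ≤ 4 * R * gbar P.β g₀ j ^ 2 * ∑ l ∈ Finset.range j, cutoffWeight Ω k l * gbar P.β g₀ l := by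
  induction j with
  | zero => simp
  | succ j ih =>
    rw [P.linG_succ, Finset.sum_range_succ]
    obtain ⟨ha0, ha2⟩ := h.aCoef_mem j
    have h1 := aCoef_mul_sq_le (P := P) (g₀ := g₀) j
    have hg := h.gbar_pos j; have hg1 := h.gbar_pos (j + 1)
    have hw := (h.weight_pos j).le
    have hS : 0 ≤ ∑ l ∈ Finset.range j, cutoffWeight Ω k l * gbar P.β g₀ l :=
      Finset.sum_nonneg fun l _ => mul_nonneg (h.weight_pos l).le (h.gbar_pos l).le
    -- `g̊_j² ≤ 4g̊_{j+1}²`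
    have h2 : gbar P.β g₀ j ^ 2 ≤ 4 * gbar P.β g₀ (j + 1) ^ 2 := by
      have := (h.gbar_succ_mem j).1; nlinarith
    calc |P.aCoef g₀ j * P.linG g₀ rg j + rg j|
        ≤ P.aCoef g₀ j * |P.linG g₀ rg j| + |rg j| := by
          refine (abs_add_le _ _).trans (le_of_eq ?_); rw [abs_mul, abs_of_nonneg ha0]
      _ ≤ P.aCoef g₀ j * (4 * R * gbar P.β g₀ j ^ 2 * ∑ l ∈ Finset.range j, cutoffWeight Ω k l * gbar P.β g₀ l) +
            R * (cutoffWeight Ω k j * gbar P.β g₀ j ^ 3) :=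
          add_le_add (mul_le_mul_of_nonneg_left ih ha0) (hrg j)
      _ = 4 * R * (P.aCoef g₀ j * gbar P.β g₀ j ^ 2) * (∑ l ∈ Finset.range j, cutoffWeight Ω k l * gbar P.β g₀ l) +
            R * gbar P.β g₀ j ^ 2 * (cutoffWeight Ω k j * gbar P.β g₀ j) := by ring
      _ ≤ 4 * R * gbar P.β g₀ (j + 1) ^ 2 * (∑ l ∈ Finset.range j, cutoffWeight Ω k l * gbar P.β g₀ l) +
            R * (4 * gbar P.β g₀ (j + 1) ^ 2) * (cutoffWeight Ω k j * gbar P.β g₀ j) := by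
          gcongr
      _ = _ := by ring

/-- **[BBS-rg-flow, Lemma 4.3, (4.15)]** (`g`-component of `S̄`): if `|r^g_l| ≤ RΩ^{-(l-k)₊}g̊_l³`
for all `l` then `|g_j| ≤ 12C_{1,0}R g̊_j²|log g̊_j|`, `C_{1,0} = (5+N)/c + N + Ω/(Ω-1)` — the weight
`𝗐_{g,j} = g̊_j²|log g̊_j|` of (3.2) (Remark 3.2: "no smaller weight will work").
[cite: BauerschmidtBrydgesSlade2015Flow, Lemma 4.3, (4.15), and Remark 3.2] -/
theorem abs_linG_le {rg : ℕ → ℝ} {R : ℝ} (hR : 0 ≤ R)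
    (hrg : ∀ l, |rg l| ≤ R * (cutoffWeight Ω k l * gbar P.β g₀ l ^ 3)) (j : ℕ) :
    |P.linG g₀ rg j| ≤ 12 * ((5 + N) / c + N + Ω / (Ω - 1)) * R *
      (gbar P.β g₀ j ^ 2 * |Real.log (gbar P.β g₀ j)|) := by
  have hG := h.toCutoffGbarHyp
  have hC10 : 0 ≤ (5 + (N : ℝ)) / c + N + Ω / (Ω - 1) := by
    have := h.c_pos; have := h.one_lt
    have : 0 ≤ Ω / (Ω - 1) := div_nonneg (by linarith) (by linarith)
    positivity
  rcases j with _ | j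
  · simp only [QuadFlowParams.linG_zero, abs_zero, gbar_zero]; positivity
  have h1 := h.abs_linG_le_sum hR hrg (j + 1)
  have h2 : ∑ l ∈ Finset.range (j + 1), cutoffWeight Ω k l * gbar P.β g₀ l ≤
      ((5 + N) / c + N + Ω / (Ω - 1)) * |Real.log (gbar P.β g₀ j)| := by
    rw [Finset.range_eq_Ico, Finset.Ico_add_one_right_eq_Icc]
    exact hG.sum_weight_mul_gbar_le 0 j
  have h3 : |Real.log (gbar P.β g₀ j)| ≤ 3 * |Real.log (gbar P.β g₀ (j + 1))| := by
    -- `|log g̊_j| ≤ |log g̊_{j+1}| + 1/2 ≤ …`: `g̊_{j+1} ≤ (3/2) g̊_j` gives `-log g̊_j ≤ -log g̊_{j+1} + log(3/2)`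
    rw [hG.abs_log_gbar, hG.abs_log_gbar]
    have hup := (hG.gbar_succ_mem j).2
    have hgj := hG.gbar_pos j; have hgj1 := hG.gbar_pos (j + 1)
    have hl := Real.log_le_log hgj1 hup
    rw [Real.log_mul (by norm_num) hgj.ne'] at hl
    have h32 : Real.log (3 / 2) ≤ 1 / 2 := by
      have := Real.log_le_sub_one_of_pos (show (0:ℝ) < 3 / 2 by norm_num); linarith
    have hhalf := hG.half_le_abs_log_gbar (j + 1)
    rw [hG.abs_log_gbar] at hhalf
    linarith
  have hg2 := sq_nonneg (gbar P.β g₀ (j + 1))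
  calc |P.linG g₀ rg (j + 1)|
      ≤ 4 * R * gbar P.β g₀ (j + 1) ^ 2 * (((5 + N) / c + N + Ω / (Ω - 1)) * |Real.log (gbar P.β g₀ j)|) :=
        h1.trans (mul_le_mul_of_nonneg_left h2 (by positivity))
    _ ≤ 4 * R * gbar P.β g₀ (j + 1) ^ 2 * (((5 + N) / c + N + Ω / (Ω - 1)) * (3 * |Real.log (gbar P.β g₀ (j + 1))|)) := by
        gcongr
    _ = _ := by ring

end CutoffQuadHyp


/-! ### The constants of Lemma 4.3 (all depending only on `Ω, c, N, C, λ`) -/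

/-- `Z = 2C·C_{2,0}`: `|z̄_j| ≤ Zχ_jḡ_j`. [cite: BauerschmidtBrydgesSlade2015Flow, Lemma 2.2, (2.15)] -/
def linZbarConst (Ω c : ℝ) (N : ℕ) (C : ℝ) : ℝ := 2 * C * ((1 + N) / c + N + 2 * Ω / (Ω - 1))

/-- `M_μ = 4K_σ/(λ-1)`: `|μ̄_j| ≤ M_μχ_jḡ_j`. [cite: BauerschmidtBrydgesSlade2015Flow, Lemma 2.2, (2.21)] -/
def linMubarConst (Ω c : ℝ) (N : ℕ) (C lam : ℝ) : ℝ :=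
  4 * (C * (3 + 3 * linZbarConst Ω c N C + linZbarConst Ω c N C ^ 2) / 2) / (lam - 1)

/-- `C_g = 12C_{1,0}`: the `g`-component of `S̄` ((4.15)). [cite: BauerschmidtBrydgesSlade2015Flow, Lemma 4.3, (4.15)] -/
def linGConst (Ω c : ℝ) (N : ℕ) : ℝ := 12 * ((5 + N) / c + N + Ω / (Ω - 1))

/-- `C_z = 4C_{2,0}(C(2+Z)C_g + 2)`: the `z`-component of `S̄` ((4.16)). [cite: BauerschmidtBrydgesSlade2015Flow, Lemma 4.3, (4.16)] -/
def linZConst (Ω c : ℝ) (N : ℕ) (C : ℝ) : ℝ :=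
  4 * ((1 + N) / c + N + 2 * Ω / (Ω - 1)) * (C * (2 + linZbarConst Ω c N C) * linGConst Ω c N + 2)

/-- `C_m = C(2 + (Z+M_μ)/2)C_g + C(3/2 + Z + M_μ/2)C_z + 1`: the source of the `μ`-component.
[cite: BauerschmidtBrydgesSlade2015Flow, Lemma 4.3, (4.17)–(4.18)] -/
def linMuSrcConst (Ω c : ℝ) (N : ℕ) (C lam : ℝ) : ℝ :=
  C * (2 + (linZbarConst Ω c N C + linMubarConst Ω c N C lam) / 2) * linGConst Ω c N +
    C * (3 / 2 + linZbarConst Ω c N C + linMubarConst Ω c N C lam / 2) * linZConst Ω c N C + 1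

/-- `C_μ = 4C_m(2/(λ-1) + 8/(λ-1)²)`: the `μ`-component of `S̄` ((4.17)). [cite: BauerschmidtBrydgesSlade2015Flow, Lemma 4.3, (4.17)] -/
def linMuConst (Ω c : ℝ) (N : ℕ) (C lam : ℝ) : ℝ :=
  4 * linMuSrcConst Ω c N C lam * (2 / (lam - 1) + 8 / (lam - 1) ^ 2)

namespace CutoffQuadHyp

variable {P : QuadFlowParams} {Ω : ℝ} {k : ℕ∞} {B c : ℝ} {N : ℕ} {C lam g₀ : ℝ}
  (h : CutoffQuadHyp P Ω k B c N C lam g₀)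
include h

/-- `C_g ≥ 0`. [cite: BauerschmidtBrydgesSlade2015Flow, Lemma 4.3] -/
theorem linGConst_nonneg : 0 ≤ linGConst Ω c N := by
  unfold linGConst
  have := h.c_pos; have := h.one_lt
  have : 0 ≤ Ω / (Ω - 1) := div_nonneg (by linarith) (by linarith)
  positivity

/-- `Z ≥ 0`. [cite: BauerschmidtBrydgesSlade2015Flow, Lemma 2.2] -/
theorem linZbarConst_nonneg : 0 ≤ linZbarConst Ω c N C := h.Z_nonneg

/-- `M_μ ≥ 0`. [cite: BauerschmidtBrydgesSlade2015Flow, Lemma 2.2] -/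
theorem linMubarConst_nonneg : 0 ≤ linMubarConst Ω c N C lam := h.Mmu_nonneg

/-- `C_z ≥ 0`. [cite: BauerschmidtBrydgesSlade2015Flow, Lemma 4.3] -/
theorem linZConst_nonneg : 0 ≤ linZConst Ω c N C := by
  unfold linZConst
  have := h.C20_nonneg; have := h.C_nonneg; have := h.linGConst_nonneg; have := h.linZbarConst_nonneg
  positivity

/-- `C_m ≥ 0`. [cite: BauerschmidtBrydgesSlade2015Flow, Lemma 4.3] -/
theorem linMuSrcConst_nonneg : 0 ≤ linMuSrcConst Ω c N C lam := by
  unfold linMuSrcConst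
  have := h.C_nonneg; have := h.linGConst_nonneg; have := h.linZbarConst_nonneg
  have := h.linMubarConst_nonneg; have := h.linZConst_nonneg
  positivity

/-- `C_μ ≥ 0`. [cite: BauerschmidtBrydgesSlade2015Flow, Lemma 4.3] -/
theorem linMuConst_nonneg : 0 ≤ linMuConst Ω c N C lam := by
  unfold linMuConst
  have := h.linMuSrcConst_nonneg; have := h.one_lt_lam
  have : 0 ≤ 2 / (lam - 1) + 8 / (lam - 1) ^ 2 := by
    have : 0 ≤ 2 / (lam - 1) := div_nonneg zero_le_two (by linarith)
    positivity
  positivity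

/-! ### Lemma 4.3, `z`-component -/

/-- The source of the `z`-equation: `|−ξ̃_lg_l + r^z_l| ≤ R(C(2+Z)C_g + 2) Ω^{-(l-k)₊}g̊_l³|log g̊_l|`.
[cite: BauerschmidtBrydgesSlade2015Flow, Lemma 4.3 (proof of (4.16))] -/
theorem abs_zSrc_le {rg rz : ℕ → ℝ} {R : ℝ} (hR : 0 ≤ R)
    (hrg : ∀ l, |rg l| ≤ R * (cutoffWeight Ω k l * gbar P.β g₀ l ^ 3))
    (hrz : ∀ l, |rz l| ≤ R * (cutoffWeight Ω k l * gbar P.β g₀ l ^ 3)) (l : ℕ) :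
    |-P.xiT g₀ l * P.linG g₀ rg l + rz l| ≤
      R * (C * (2 + linZbarConst Ω c N C) * linGConst Ω c N + 2) *
        (cutoffWeight Ω k l * gbar P.β g₀ l ^ 3 * |Real.log (gbar P.β g₀ l)|) := by
  have hG := h.toCutoffGbarHyp
  have hxi := h.abs_xiT_le l
  have hgl := h.abs_linG_le hR hrg l
  have hL := hG.half_le_abs_log_gbar l
  have hw := (h.weight_pos l).le; have hg := (h.gbar_pos l).le
  have hC := h.C_nonneg; have hZ := h.linZbarConst_nonneg; have hCg := h.linGConst_nonneg
  change |P.xiT g₀ l| ≤ C * (2 + linZbarConst Ω c N C) * (cutoffWeight Ω k l * gbar P.β g₀ l) at hxi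
  change |P.linG g₀ rg l| ≤ linGConst Ω c N * R * (gbar P.β g₀ l ^ 2 * |Real.log (gbar P.β g₀ l)|) at hgl
  set w := cutoffWeight Ω k l; set g := gbar P.β g₀ l; set L := |Real.log g|
  set Cxi := C * (2 + linZbarConst Ω c N C)
  set Cg := linGConst Ω c N
  have hCxi : 0 ≤ Cxi := by positivity
  calc |-P.xiT g₀ l * P.linG g₀ rg l + rz l| ≤ |P.xiT g₀ l| * |P.linG g₀ rg l| + |rz l| := by
        refine (abs_add_le _ _).trans (le_of_eq ?_); rw [abs_mul, abs_neg]
    _ ≤ Cxi * (w * g) * (Cg * R * (g ^ 2 * L)) + R * (w * g ^ 3) :=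
        add_le_add (mul_le_mul hxi hgl (abs_nonneg _) (by positivity)) (hrz l)
    _ = R * (Cxi * Cg) * (w * g ^ 3 * L) + R * (w * g ^ 3) := by ring
    _ ≤ R * (Cxi * Cg) * (w * g ^ 3 * L) + R * (w * g ^ 3) * (2 * L) := by
        have : 0 ≤ R * (w * g ^ 3) := by positivity
        nlinarith
    _ = R * (Cxi * Cg + 2) * (w * g ^ 3 * L) := by ring

/-- Termwise bound for the `z`-series of (4.11). [cite: BauerschmidtBrydgesSlade2015Flow, Lemma 4.3 (proof of (4.16))] -/
theorem abs_linZ_term_le {rg rz : ℕ → ℝ} {R : ℝ} (hR : 0 ≤ R)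
    (hrg : ∀ l, |rg l| ≤ R * (cutoffWeight Ω k l * gbar P.β g₀ l ^ 3))
    (hrz : ∀ l, |rz l| ≤ R * (cutoffWeight Ω k l * gbar P.β g₀ l ^ 3)) (j l : ℕ) :
    |P.czInvProd g₀ j l * (-P.xiT g₀ (l + j) * P.linG g₀ rg (l + j) + rz (l + j))| ≤
      2 * (R * (C * (2 + linZbarConst Ω c N C) * linGConst Ω c N + 2)) *
        (cutoffWeight Ω k (l + j) * gbar P.β g₀ (l + j) ^ 3 * |Real.log (gbar P.β g₀ (l + j))|) := by
  obtain ⟨h0, h2⟩ := h.czInvProd_mem j l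
  rw [abs_mul, abs_of_nonneg h0, mul_assoc]
  exact mul_le_mul h2 (h.abs_zSrc_le hR hrg hrz (l + j)) (abs_nonneg _) zero_le_two

/-- The `z`-series converges absolutely (extra smallness `4g₀ ≤ e⁻¹`). [cite: BauerschmidtBrydgesSlade2015Flow, Lemma 4.2 ("for which the series (4.11) converges")] -/
theorem summable_linZ_term (hsmall : 4 * g₀ ≤ Real.exp (-1)) {rg rz : ℕ → ℝ} {R : ℝ} (hR : 0 ≤ R)
    (hrg : ∀ l, |rg l| ≤ R * (cutoffWeight Ω k l * gbar P.β g₀ l ^ 3))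
    (hrz : ∀ l, |rz l| ≤ R * (cutoffWeight Ω k l * gbar P.β g₀ l ^ 3)) (j : ℕ) :
    Summable fun l => P.czInvProd g₀ j l * (-P.xiT g₀ (l + j) * P.linG g₀ rg (l + j) + rz (l + j)) :=
  Summable.of_norm_bounded (((h.tsum_weight_mul_gbar_cube_log_le hsmall j).1).mul_left _) fun l => by
    rw [Real.norm_eq_abs]; exact h.abs_linZ_term_le hR hrg hrz j l

/-- **The `z`-row of (4.5)**: `z_{j+1} = -ξ̃_jg_j + (1 - ζ_jg̊_j)z_j + r^z_j`.
[cite: BauerschmidtBrydgesSlade2015Flow, Lemma 4.2 (proof: v_{j+1} = B_ju_j + C_jv_j + π_vr_j)] -/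
theorem linZ_succ (hsmall : 4 * g₀ ≤ Real.exp (-1)) {rg rz : ℕ → ℝ} {R : ℝ} (hR : 0 ≤ R)
    (hrg : ∀ l, |rg l| ≤ R * (cutoffWeight Ω k l * gbar P.β g₀ l ^ 3))
    (hrz : ∀ l, |rz l| ≤ R * (cutoffWeight Ω k l * gbar P.β g₀ l ^ 3)) (j : ℕ) :
    P.linZ g₀ rg rz (j + 1) =
      -P.xiT g₀ j * P.linG g₀ rg j + P.czCoef g₀ j * P.linZ g₀ rg rz j + rz j := by
  have hs := h.summable_linZ_term hsmall hR hrg hrz j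
  have hc : P.czCoef g₀ j ≠ 0 := by linarith [(h.czCoef_mem j).1]
  set s : ℕ → ℝ := fun l => -P.xiT g₀ l * P.linG g₀ rg l + rz l with hsdef
  have key : P.linZ g₀ rg rz j = (P.czCoef g₀ j)⁻¹ * (P.linZ g₀ rg rz (j + 1) - s j) := by
    rw [QuadFlowParams.linZ, QuadFlowParams.linZ, hs.tsum_eq_zero_add]
    simp only [zero_add, P.czInvProd_zero]
    have h2 : ∑' l, P.czInvProd g₀ j (l + 1) * (-P.xiT g₀ (l + 1 + j) * P.linG g₀ rg (l + 1 + j) + rz (l + 1 + j)) =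
        (P.czCoef g₀ j)⁻¹ * ∑' l, P.czInvProd g₀ (j + 1) l *
          (-P.xiT g₀ (l + (j + 1)) * P.linG g₀ rg (l + (j + 1)) + rz (l + (j + 1))) := by
      rw [← tsum_mul_left]
      exact tsum_congr fun l => by rw [P.czInvProd_succ, Nat.add_right_comm, Nat.add_assoc]; ring
    rw [h2]; simp only [hsdef]; ring
  set Zj := P.linZ g₀ rg rz (j + 1)
  rw [key]
  simp only [hsdef]
  field_simp
  ring

/-- **[BBS-rg-flow, Lemma 4.3, (4.16)]** (`z`-component of `S̄`): if `|r^g_l|, |r^z_l| ≤ RΩ^{-(l-k)₊}g̊_l³`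
then `|z_j| ≤ C_z R Ω^{-(j-k)₊}g̊_j²|log g̊_j|` — the weight `𝗐_{z,j}` of (3.2).
[cite: BauerschmidtBrydgesSlade2015Flow, Lemma 4.3, (4.16)] -/
theorem abs_linZ_le (hsmall : 4 * g₀ ≤ Real.exp (-1)) {rg rz : ℕ → ℝ} {R : ℝ} (hR : 0 ≤ R)
    (hrg : ∀ l, |rg l| ≤ R * (cutoffWeight Ω k l * gbar P.β g₀ l ^ 3))
    (hrz : ∀ l, |rz l| ≤ R * (cutoffWeight Ω k l * gbar P.β g₀ l ^ 3)) (j : ℕ) :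
    |P.linZ g₀ rg rz j| ≤ linZConst Ω c N C * R *
      (cutoffWeight Ω k j * gbar P.β g₀ j ^ 2 * |Real.log (gbar P.β g₀ j)|) := by
  have hs := h.summable_linZ_term hsmall hR hrg hrz j
  obtain ⟨hsum, htsum⟩ := h.tsum_weight_mul_gbar_cube_log_le hsmall j
  set A := R * (C * (2 + linZbarConst Ω c N C) * linGConst Ω c N + 2) with hA
  rw [QuadFlowParams.linZ, abs_neg]
  calc |∑' l, P.czInvProd g₀ j l * (-P.xiT g₀ (l + j) * P.linG g₀ rg (l + j) + rz (l + j))|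
      ≤ ∑' l, |P.czInvProd g₀ j l * (-P.xiT g₀ (l + j) * P.linG g₀ rg (l + j) + rz (l + j))| := by
        have := norm_tsum_le_tsum_norm
          (f := fun l => P.czInvProd g₀ j l * (-P.xiT g₀ (l + j) * P.linG g₀ rg (l + j) + rz (l + j)))
          (by simpa only [Real.norm_eq_abs] using hs.abs)
        simpa only [Real.norm_eq_abs] using this
    _ ≤ ∑' l, 2 * A * (cutoffWeight Ω k (l + j) * gbar P.β g₀ (l + j) ^ 3 * |Real.log (gbar P.β g₀ (l + j))|) :=
        Summable.tsum_le_tsum (h.abs_linZ_term_le hR hrg hrz j) hs.abs (hsum.mul_left _)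
    _ = 2 * A * ∑' l, cutoffWeight Ω k (l + j) * gbar P.β g₀ (l + j) ^ 3 * |Real.log (gbar P.β g₀ (l + j))| :=
        tsum_mul_left
    _ ≤ 2 * A * (2 * ((1 + N) / c + N + 2 * Ω / (Ω - 1)) *
          (cutoffWeight Ω k j * gbar P.β g₀ j ^ 2 * |Real.log (gbar P.β g₀ j)|)) := by
        refine mul_le_mul_of_nonneg_left htsum ?_
        have := h.C_nonneg; have := h.linZbarConst_nonneg; have := h.linGConst_nonneg
        positivity
    _ = _ := by rw [hA, linZConst]; ring

/-! ### Lemma 4.3, `μ`-component -/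

/-- `g̊_l|log g̊_l| ≤ 1` (indeed `t|log t| ≤ e⁻¹`); hence `𝗐_{z,j} = χ_jg̊_j²|log g̊_j| ≤ χ_jg̊_j → 0`.
[folklore] -/
theorem gbar_mul_abs_log_le_one (l : ℕ) : gbar P.β g₀ l * |Real.log (gbar P.β g₀ l)| ≤ 1 := by
  have hG := h.toCutoffGbarHyp
  have hg := hG.gbar_pos l
  rw [hG.abs_log_gbar]
  have := Real.one_sub_inv_le_log_of_pos hg
  have hinv : gbar P.β g₀ l * (gbar P.β g₀ l)⁻¹ = 1 := mul_inv_cancel₀ hg.ne'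
  nlinarith

/-- `|log g̊_{l+j}| ≤ |log g̊_j| + l` (as `g̊_{i+1} ≥ g̊_i/2` and `log 2 ≤ 1`).
[cite: BauerschmidtBrydgesSlade2015Flow, Lemma 2.1(i), (2.2)] -/
theorem abs_log_gbar_add_le (j l : ℕ) :
    |Real.log (gbar P.β g₀ (l + j))| ≤ |Real.log (gbar P.β g₀ j)| + l := by
  have hG := h.toCutoffGbarHyp
  induction l with
  | zero => simp
  | succ l ih =>
    rw [Nat.add_right_comm, hG.abs_log_gbar]
    rw [hG.abs_log_gbar] at ih
    have hlow := (hG.gbar_succ_mem (l + j)).1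
    have hg := hG.gbar_pos (l + j); have hg1 := hG.gbar_pos (l + j + 1)
    have := Real.log_le_log (by positivity) hlow
    rw [Real.log_div hg.ne' (by norm_num)] at this
    have h2 := Real.log_le_sub_one_of_pos (show (0:ℝ) < 2 by norm_num)
    push_cast
    linarith

/-- The source of the `μ`-equation: `|η̃_lg_l + γ̃_lz_l + r^μ_l| ≤ C_m R Ω^{-(l-k)₊}g̊_l²|log g̊_l|`.
[cite: BauerschmidtBrydgesSlade2015Flow, Lemma 4.3 (proof of (4.17), the two displays (4.18))] -/
theorem abs_muSrc_le (hsmall : 4 * g₀ ≤ Real.exp (-1)) {rg rz rμ : ℕ → ℝ} {R : ℝ} (hR : 0 ≤ R)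
    (hrg : ∀ l, |rg l| ≤ R * (cutoffWeight Ω k l * gbar P.β g₀ l ^ 3))
    (hrz : ∀ l, |rz l| ≤ R * (cutoffWeight Ω k l * gbar P.β g₀ l ^ 3))
    (hrμ : ∀ l, |rμ l| ≤ R * (cutoffWeight Ω k l * gbar P.β g₀ l ^ 3)) (l : ℕ) :
    |P.etaT g₀ l * P.linG g₀ rg l + P.gammaT g₀ l * P.linZ g₀ rg rz l + rμ l| ≤
      linMuSrcConst Ω c N C lam * R *
        (cutoffWeight Ω k l * gbar P.β g₀ l ^ 2 * |Real.log (gbar P.β g₀ l)|) := by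
  have hG := h.toCutoffGbarHyp
  have hη := h.abs_etaT_le l
  have hγ := h.abs_gammaT_le l
  have hgl := h.abs_linG_le hR hrg l
  have hzl := h.abs_linZ_le hsmall hR hrg hrz l
  have hL := hG.half_le_abs_log_gbar l
  have hw := (h.weight_pos l).le; have hw1 := h.weight_le_one l
  have hg := (h.gbar_pos l).le; have hg2 := h.gbar_le_half l
  have hC := h.C_nonneg; have hZ := h.linZbarConst_nonneg; have hCg := h.linGConst_nonneg
  have hM := h.linMubarConst_nonneg; have hCz := h.linZConst_nonneg
  set Z := linZbarConst Ω c N C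
  set Mμ := linMubarConst Ω c N C lam
  change |P.etaT g₀ l| ≤ C * (2 + (Z + Mμ) / 2) * cutoffWeight Ω k l at hη
  change |P.gammaT g₀ l| ≤ C * (3 / 2 + Z + Mμ / 2) * cutoffWeight Ω k l at hγ
  change |P.linG g₀ rg l| ≤ linGConst Ω c N * R * (gbar P.β g₀ l ^ 2 * |Real.log (gbar P.β g₀ l)|) at hgl
  set w := cutoffWeight Ω k l; set g := gbar P.β g₀ l; set L := |Real.log g|
  set Ceta := C * (2 + (Z + Mμ) / 2)
  set Cgam := C * (3 / 2 + Z + Mμ / 2)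
  set Cg := linGConst Ω c N
  set Cz := linZConst Ω c N C
  have hCeta : 0 ≤ Ceta := by positivity
  have hCgam : 0 ≤ Cgam := by positivity
  calc |P.etaT g₀ l * P.linG g₀ rg l + P.gammaT g₀ l * P.linZ g₀ rg rz l + rμ l|
      ≤ |P.etaT g₀ l| * |P.linG g₀ rg l| + |P.gammaT g₀ l| * |P.linZ g₀ rg rz l| + |rμ l| := by
        refine (abs_add_le _ _).trans (add_le_add ((abs_add_le _ _).trans (le_of_eq ?_)) le_rfl)
        rw [abs_mul, abs_mul]
    _ ≤ Ceta * w * (Cg * R * (g ^ 2 * L)) + Cgam * w * (Cz * R * (w * g ^ 2 * L)) + R * (w * g ^ 3) :=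
        add_le_add (add_le_add (mul_le_mul hη hgl (abs_nonneg _) (by positivity))
          (mul_le_mul hγ hzl (abs_nonneg _) (by positivity))) (hrμ l)
    _ ≤ Ceta * w * (Cg * R * (g ^ 2 * L)) + Cgam * w * (Cz * R * (1 * g ^ 2 * L)) + R * (w * g ^ 2 * L) := by
        have h3 : w * g ^ 3 ≤ w * g ^ 2 * L := by
          have : g ≤ L := by linarith
          calc w * g ^ 3 = w * g ^ 2 * g := by ring
            _ ≤ w * g ^ 2 * L := mul_le_mul_of_nonneg_left this (by positivity)
        gcongr
    _ = (Ceta * Cg + Cgam * Cz + 1) * R * (w * g ^ 2 * L) := by ring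
    _ = _ := by rfl

/-- Termwise bound for the `μ`-series of (4.11):
`|∏λ̃⁻¹ m_{l+j}| ≤ 4C_mR α^{l+1} Ω^{-(j-k)₊}g̊_j²(|log g̊_j| + l)`.
[cite: BauerschmidtBrydgesSlade2015Flow, Lemma 4.3 (proof of (4.17), last display)] -/
theorem abs_linMu_term_le (hsmall : 4 * g₀ ≤ Real.exp (-1)) {rg rz rμ : ℕ → ℝ} {R : ℝ} (hR : 0 ≤ R)
    (hrg : ∀ l, |rg l| ≤ R * (cutoffWeight Ω k l * gbar P.β g₀ l ^ 3))
    (hrz : ∀ l, |rz l| ≤ R * (cutoffWeight Ω k l * gbar P.β g₀ l ^ 3))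
    (hrμ : ∀ l, |rμ l| ≤ R * (cutoffWeight Ω k l * gbar P.β g₀ l ^ 3)) (j l : ℕ) :
    |P.lamTInvProd g₀ j l *
        (P.etaT g₀ (l + j) * P.linG g₀ rg (l + j) + P.gammaT g₀ (l + j) * P.linZ g₀ rg rz (l + j) + rμ (l + j))| ≤
      4 * linMuSrcConst Ω c N C lam * R * (cutoffWeight Ω k j * gbar P.β g₀ j ^ 2) *
        ((2 / (1 + lam)) ^ (l + 1) * (|Real.log (gbar P.β g₀ j)| + l)) := by
  have hG := h.toCutoffGbarHyp
  obtain ⟨hP0, hP1⟩ := h.lamTInvProd_mem j l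
  have hm := h.abs_muSrc_le hsmall hR hrg hrz hrμ (l + j)
  have hCm := h.linMuSrcConst_nonneg
  rw [abs_mul, abs_of_nonneg hP0]
  have h1 := hG.gbar_le_two_mul (Nat.le_add_left j l)
  have h2 := cutoffWeight_antitone hG.one_le k (Nat.le_add_left j l)
  have h3 := h.abs_log_gbar_add_le j l
  have hw := (h.weight_pos (l + j)).le; have hg := (h.gbar_pos (l + j)).le
  have hwj := (h.weight_pos j).le; have hgj := (h.gbar_pos j).le
  have hmono : cutoffWeight Ω k (l + j) * gbar P.β g₀ (l + j) ^ 2 * |Real.log (gbar P.β g₀ (l + j))| ≤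
      4 * (cutoffWeight Ω k j * gbar P.β g₀ j ^ 2) * (|Real.log (gbar P.β g₀ j)| + l) := by
    calc cutoffWeight Ω k (l + j) * gbar P.β g₀ (l + j) ^ 2 * |Real.log (gbar P.β g₀ (l + j))|
        ≤ cutoffWeight Ω k j * (2 * gbar P.β g₀ j) ^ 2 * (|Real.log (gbar P.β g₀ j)| + l) := by
          refine mul_le_mul (mul_le_mul h2 (pow_le_pow_left₀ hg h1 2) (by positivity) hwj) h3
            (abs_nonneg _) (by positivity)
      _ = _ := by ring
  calc P.lamTInvProd g₀ j l *
        |P.etaT g₀ (l + j) * P.linG g₀ rg (l + j) + P.gammaT g₀ (l + j) * P.linZ g₀ rg rz (l + j) + rμ (l + j)|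
      ≤ (2 / (1 + lam)) ^ (l + 1) * (linMuSrcConst Ω c N C lam * R *
          (4 * (cutoffWeight Ω k j * gbar P.β g₀ j ^ 2) * (|Real.log (gbar P.β g₀ j)| + l))) :=
        mul_le_mul hP1 (hm.trans (mul_le_mul_of_nonneg_left hmono (by positivity))) (abs_nonneg _)
          (pow_nonneg h.alpha_mem.1 _)
    _ = _ := by ring

omit h in
/-- The majorant `α^{l+1}(L + l)` is summable with sum `αL/(1-α) + α²/(1-α)²`. [folklore] -/
theorem hasSum_geom_lin {α L : ℝ} (hα0 : 0 ≤ α) (hα1 : α < 1) :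
    HasSum (fun l : ℕ => α ^ (l + 1) * (L + l)) (α * L / (1 - α) + α ^ 2 / (1 - α) ^ 2) := by
  have hnorm : ‖α‖ < 1 := by rw [Real.norm_eq_abs, abs_of_nonneg hα0]; exact hα1
  have h1 : HasSum (fun l : ℕ => α * L * α ^ l) (α * L * (1 - α)⁻¹) :=
    (hasSum_geometric_of_lt_one hα0 hα1).mul_left (α * L)
  have h2 : HasSum (fun l : ℕ => α * ((l : ℝ) * α ^ l)) (α * (α / (1 - α) ^ 2)) :=
    (hasSum_coe_mul_geometric_of_norm_lt_one hnorm).mul_left α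
  have h3 := h1.add h2
  have hf : (fun l : ℕ => α ^ (l + 1) * (L + l)) = fun l : ℕ => α * L * α ^ l + α * ((l : ℝ) * α ^ l) := by
    funext l; ring
  have hv : α * L / (1 - α) + α ^ 2 / (1 - α) ^ 2 = α * L * (1 - α)⁻¹ + α * (α / (1 - α) ^ 2) := by ring
  rw [hf, hv]; exact h3

/-- The `μ`-series converges absolutely. [cite: BauerschmidtBrydgesSlade2015Flow, Lemma 4.2 ("for which the series (4.11) converges")] -/
theorem summable_linMu_term (hsmall : 4 * g₀ ≤ Real.exp (-1)) {rg rz rμ : ℕ → ℝ} {R : ℝ} (hR : 0 ≤ R)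
    (hrg : ∀ l, |rg l| ≤ R * (cutoffWeight Ω k l * gbar P.β g₀ l ^ 3))
    (hrz : ∀ l, |rz l| ≤ R * (cutoffWeight Ω k l * gbar P.β g₀ l ^ 3))
    (hrμ : ∀ l, |rμ l| ≤ R * (cutoffWeight Ω k l * gbar P.β g₀ l ^ 3)) (j : ℕ) :
    Summable fun l => P.lamTInvProd g₀ j l *
      (P.etaT g₀ (l + j) * P.linG g₀ rg (l + j) + P.gammaT g₀ (l + j) * P.linZ g₀ rg rz (l + j) + rμ (l + j)) := by
  obtain ⟨hα0, hα1⟩ := h.alpha_mem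
  refine Summable.of_norm_bounded (((hasSum_geom_lin (L := |Real.log (gbar P.β g₀ j)|) hα0 hα1).summable).mul_left
    (4 * linMuSrcConst Ω c N C lam * R * (cutoffWeight Ω k j * gbar P.β g₀ j ^ 2))) fun l => ?_
  rw [Real.norm_eq_abs]
  exact h.abs_linMu_term_le hsmall hR hrg hrz hrμ j l

/-- **The `μ`-row of (4.5)**: `μ_{j+1} = η̃_jg_j + γ̃_jz_j + λ̃_jμ_j + r^μ_j`.
[cite: BauerschmidtBrydgesSlade2015Flow, Lemma 4.2 (proof: v_{j+1} = B_ju_j + C_jv_j + π_vr_j)] -/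
theorem linMu_succ (hsmall : 4 * g₀ ≤ Real.exp (-1)) {rg rz rμ : ℕ → ℝ} {R : ℝ} (hR : 0 ≤ R)
    (hrg : ∀ l, |rg l| ≤ R * (cutoffWeight Ω k l * gbar P.β g₀ l ^ 3))
    (hrz : ∀ l, |rz l| ≤ R * (cutoffWeight Ω k l * gbar P.β g₀ l ^ 3))
    (hrμ : ∀ l, |rμ l| ≤ R * (cutoffWeight Ω k l * gbar P.β g₀ l ^ 3)) (j : ℕ) :
    P.linMu g₀ rg rz rμ (j + 1) =
      P.etaT g₀ j * P.linG g₀ rg j + P.gammaT g₀ j * P.linZ g₀ rg rz j +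
        P.lamT g₀ j * P.linMu g₀ rg rz rμ j + rμ j := by
  have hs := h.summable_linMu_term hsmall hR hrg hrz hrμ j
  have hΛ : P.lamT g₀ j ≠ 0 := by linarith [h.lamT_ge j, h.one_lt_lam]
  set m : ℕ → ℝ := fun l => P.etaT g₀ l * P.linG g₀ rg l + P.gammaT g₀ l * P.linZ g₀ rg rz l + rμ l
    with hmdef
  have key : P.linMu g₀ rg rz rμ j = (P.lamT g₀ j)⁻¹ * (P.linMu g₀ rg rz rμ (j + 1) - m j) := by
    rw [QuadFlowParams.linMu, QuadFlowParams.linMu, hs.tsum_eq_zero_add]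
    simp only [zero_add, P.lamTInvProd_zero]
    have h2 : ∑' l, P.lamTInvProd g₀ j (l + 1) *
          (P.etaT g₀ (l + 1 + j) * P.linG g₀ rg (l + 1 + j) +
            P.gammaT g₀ (l + 1 + j) * P.linZ g₀ rg rz (l + 1 + j) + rμ (l + 1 + j)) =
        (P.lamT g₀ j)⁻¹ * ∑' l, P.lamTInvProd g₀ (j + 1) l *
          (P.etaT g₀ (l + (j + 1)) * P.linG g₀ rg (l + (j + 1)) +
            P.gammaT g₀ (l + (j + 1)) * P.linZ g₀ rg rz (l + (j + 1)) + rμ (l + (j + 1))) := by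
      rw [← tsum_mul_left]
      exact tsum_congr fun l => by rw [P.lamTInvProd_succ, Nat.add_right_comm, Nat.add_assoc]; ring
    rw [h2]; simp only [hmdef]; ring
  set Mj := P.linMu g₀ rg rz rμ (j + 1)
  rw [key]
  simp only [hmdef]
  field_simp
  ring

/-- **[BBS-rg-flow, Lemma 4.3, (4.17)]** (`μ`-component of `S̄`): if `|r^g_l|, |r^z_l|, |r^μ_l| ≤
RΩ^{-(l-k)₊}g̊_l³` then `|μ_j| ≤ C_μ R Ω^{-(j-k)₊}g̊_j²|log g̊_j|` — the weight `𝗐_{μ,j}` of (3.2).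
[cite: BauerschmidtBrydgesSlade2015Flow, Lemma 4.3, (4.17)–(4.18)] -/
theorem abs_linMu_le (hsmall : 4 * g₀ ≤ Real.exp (-1)) {rg rz rμ : ℕ → ℝ} {R : ℝ} (hR : 0 ≤ R)
    (hrg : ∀ l, |rg l| ≤ R * (cutoffWeight Ω k l * gbar P.β g₀ l ^ 3))
    (hrz : ∀ l, |rz l| ≤ R * (cutoffWeight Ω k l * gbar P.β g₀ l ^ 3))
    (hrμ : ∀ l, |rμ l| ≤ R * (cutoffWeight Ω k l * gbar P.β g₀ l ^ 3)) (j : ℕ) :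
    |P.linMu g₀ rg rz rμ j| ≤ linMuConst Ω c N C lam * R *
      (cutoffWeight Ω k j * gbar P.β g₀ j ^ 2 * |Real.log (gbar P.β g₀ j)|) := by
  have hG := h.toCutoffGbarHyp
  have hs := h.summable_linMu_term hsmall hR hrg hrz hrμ j
  obtain ⟨hα0, hα1⟩ := h.alpha_mem
  have hlam := h.one_lt_lam
  set α : ℝ := 2 / (1 + lam) with hα
  set Lj := |Real.log (gbar P.β g₀ j)| with hLj
  set X := cutoffWeight Ω k j * gbar P.β g₀ j ^ 2 with hX
  set A := 4 * linMuSrcConst Ω c N C lam * R * X with hA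
  have hgeo := (hasSum_geom_lin (L := Lj) hα0 hα1).mul_left A
  have hA0 : 0 ≤ A := by have := h.linMuSrcConst_nonneg; rw [hA, hX]; have := (h.weight_pos j).le; positivity
  have hLj : 1 / 2 ≤ Lj := hG.half_le_abs_log_gbar j
  rw [QuadFlowParams.linMu, abs_neg]
  calc |∑' l, P.lamTInvProd g₀ j l *
          (P.etaT g₀ (l + j) * P.linG g₀ rg (l + j) + P.gammaT g₀ (l + j) * P.linZ g₀ rg rz (l + j) + rμ (l + j))|
      ≤ ∑' l, |P.lamTInvProd g₀ j l *
          (P.etaT g₀ (l + j) * P.linG g₀ rg (l + j) + P.gammaT g₀ (l + j) * P.linZ g₀ rg rz (l + j) + rμ (l + j))| := by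
        have := norm_tsum_le_tsum_norm (f := fun l => P.lamTInvProd g₀ j l *
          (P.etaT g₀ (l + j) * P.linG g₀ rg (l + j) + P.gammaT g₀ (l + j) * P.linZ g₀ rg rz (l + j) + rμ (l + j)))
          (by simpa only [Real.norm_eq_abs] using hs.abs)
        simpa only [Real.norm_eq_abs] using this
    _ ≤ ∑' l : ℕ, A * (α ^ (l + 1) * (Lj + l)) :=
        Summable.tsum_le_tsum (fun l => h.abs_linMu_term_le hsmall hR hrg hrz hrμ j l) hs.abs hgeo.summable
    _ = A * (α * Lj / (1 - α) + α ^ 2 / (1 - α) ^ 2) := hgeo.tsum_eq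
    _ ≤ A * ((α / (1 - α) + 2 * α ^ 2 / (1 - α) ^ 2) * Lj) := by
        refine mul_le_mul_of_nonneg_left ?_ hA0
        have h1a : 0 < 1 - α := by linarith
        have e1 : α * Lj / (1 - α) = α / (1 - α) * Lj := by ring
        have e2 : α ^ 2 / (1 - α) ^ 2 ≤ 2 * α ^ 2 / (1 - α) ^ 2 * Lj := by
          have hq : 0 ≤ α ^ 2 / (1 - α) ^ 2 := by positivity
          calc α ^ 2 / (1 - α) ^ 2 = α ^ 2 / (1 - α) ^ 2 * 1 := (mul_one _).symm
            _ ≤ α ^ 2 / (1 - α) ^ 2 * (2 * Lj) := mul_le_mul_of_nonneg_left (by linarith) hq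
            _ = _ := by ring
        rw [e1]; nlinarith
    _ = linMuConst Ω c N C lam * R * (X * Lj) := by
        -- `α/(1-α) = 2/(λ-1)`, `α²/(1-α)² = 4/(λ-1)²`
        have hne1 : lam - 1 ≠ 0 := by linarith
        have hne2 : 1 + lam ≠ 0 := by linarith
        have h1α : 1 - α = (lam - 1) / (1 + lam) := by
          rw [hα, eq_div_iff hne2, sub_mul, div_mul_cancel₀ _ hne2]; ring
        have q1 : α / (1 - α) = 2 / (lam - 1) := by
          rw [h1α, hα, div_div_eq_mul_div, div_mul_cancel₀ _ hne2]
        have q2 : α ^ 2 / (1 - α) ^ 2 = 4 / (lam - 1) ^ 2 := by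
          rw [← div_pow, q1, div_pow]
          try norm_num
        rw [hA, linMuConst, mul_div_assoc, q2, q1]
        ring

/-- `z_j → 0` and `μ_j → 0` (the final conditions `v_∞ = 0`), since `χ_jg̊_j²|log g̊_j| ≤ χ_jg̊_j → 0`.
[cite: BauerschmidtBrydgesSlade2015Flow, Lemma 4.2 (v_∞ = 0) and Lemma 4.3] -/
theorem tendsto_linZ_linMu_zero (hsmall : 4 * g₀ ≤ Real.exp (-1)) {rg rz rμ : ℕ → ℝ} {R : ℝ} (hR : 0 ≤ R)
    (hrg : ∀ l, |rg l| ≤ R * (cutoffWeight Ω k l * gbar P.β g₀ l ^ 3))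
    (hrz : ∀ l, |rz l| ≤ R * (cutoffWeight Ω k l * gbar P.β g₀ l ^ 3))
    (hrμ : ∀ l, |rμ l| ≤ R * (cutoffWeight Ω k l * gbar P.β g₀ l ^ 3)) :
    Tendsto (P.linZ g₀ rg rz) atTop (𝓝 0) ∧ Tendsto (P.linMu g₀ rg rz rμ) atTop (𝓝 0) := by
  have hwt : Tendsto (fun j => cutoffWeight Ω k j * gbar P.β g₀ j ^ 2 * |Real.log (gbar P.β g₀ j)|) atTop (𝓝 0) := by
    refine squeeze_zero (fun j => by have := (h.weight_pos j).le; positivity) (fun j => ?_)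
      h.tendsto_weight_mul_gbar_zero
    have h1 := h.gbar_mul_abs_log_le_one j
    have := (h.weight_pos j).le; have := (h.gbar_pos j).le
    calc cutoffWeight Ω k j * gbar P.β g₀ j ^ 2 * |Real.log (gbar P.β g₀ j)|
        = cutoffWeight Ω k j * gbar P.β g₀ j * (gbar P.β g₀ j * |Real.log (gbar P.β g₀ j)|) := by ring
      _ ≤ cutoffWeight Ω k j * gbar P.β g₀ j * 1 := mul_le_mul_of_nonneg_left h1 (by positivity)
      _ = _ := mul_one _
  constructor
  · refine squeeze_zero_norm (fun j => (Real.norm_eq_abs _).trans_le (h.abs_linZ_le hsmall hR hrg hrz j)) ?_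
    simpa using hwt.const_mul (linZConst Ω c N C * R)
  · refine squeeze_zero_norm (fun j => (Real.norm_eq_abs _).trans_le (h.abs_linMu_le hsmall hR hrg hrz hrμ j)) ?_
    simpa using hwt.const_mul (linMuConst Ω c N C lam * R)

/-- **[BBS-rg-flow, Lemmas 4.2–4.3] (componentwise)**: for sources `r = (r^g, r^z, r^μ)` with
`|r^α_l| ≤ RΩ^{-(l-k)₊}g̊_l³` (`‖r‖_{X^𝗏} ≤ R`), the sequences `(g, z, μ) = S̄_{VV}r` defined by (4.10)–(4.11)
solve the `V`-block of `y_{j+1} = L_jy_j + r_j` (`g_{j+1} = a_jg_j + r^g_j`,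
`z_{j+1} = -ξ̃_jg_j + (1-ζ_jg̊_j)z_j + r^z_j`, `μ_{j+1} = η̃_jg_j + γ̃_jz_j + λ̃_jμ_j + r^μ_j`) with the
boundary conditions `g₀ = 0`, `(z_∞, μ_∞) = (0,0)`, and obey the bounds (4.14) `‖S̄_{VV}‖ ≤ C_S̄`:
`|g_j| ≤ C_gR g̊_j²|log g̊_j|`, `|z_j| ≤ C_zR χ_jg̊_j²|log g̊_j|`, `|μ_j| ≤ C_μR χ_jg̊_j²|log g̊_j|`, with
`C_g, C_z, C_μ` depending only on `(Ω, c, N, C, λ)` — independent of the parameters `a, h` of `D_j`,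
of the cut-off and of `g₀` (extra smallness `4g₀ ≤ e⁻¹`). (The `K`-row of `S̄` is the identity shift
`K_j = r^K_{j-1}`, `S̄ = diag(1, S̄_{VV})`, (4.13).)
[cite: BauerschmidtBrydgesSlade2015Flow, Lemma 4.2, (4.10)–(4.11), and Lemma 4.3, (4.13)–(4.14)] -/
theorem linSol_spec (hsmall : 4 * g₀ ≤ Real.exp (-1)) {rg rz rμ : ℕ → ℝ} {R : ℝ} (hR : 0 ≤ R)
    (hrg : ∀ l, |rg l| ≤ R * (cutoffWeight Ω k l * gbar P.β g₀ l ^ 3))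
    (hrz : ∀ l, |rz l| ≤ R * (cutoffWeight Ω k l * gbar P.β g₀ l ^ 3))
    (hrμ : ∀ l, |rμ l| ≤ R * (cutoffWeight Ω k l * gbar P.β g₀ l ^ 3)) :
    (P.linG g₀ rg 0 = 0 ∧
      (∀ j, P.linG g₀ rg (j + 1) = P.aCoef g₀ j * P.linG g₀ rg j + rg j) ∧
      (∀ j, P.linZ g₀ rg rz (j + 1) = -P.xiT g₀ j * P.linG g₀ rg j + P.czCoef g₀ j * P.linZ g₀ rg rz j + rz j) ∧
      (∀ j, P.linMu g₀ rg rz rμ (j + 1) = P.etaT g₀ j * P.linG g₀ rg j + P.gammaT g₀ j * P.linZ g₀ rg rz j +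
        P.lamT g₀ j * P.linMu g₀ rg rz rμ j + rμ j)) ∧
    (Tendsto (P.linZ g₀ rg rz) atTop (𝓝 0) ∧ Tendsto (P.linMu g₀ rg rz rμ) atTop (𝓝 0)) ∧
    (∀ j, |P.linG g₀ rg j| ≤ linGConst Ω c N * R * (gbar P.β g₀ j ^ 2 * |Real.log (gbar P.β g₀ j)|) ∧
      |P.linZ g₀ rg rz j| ≤ linZConst Ω c N C * R *
        (cutoffWeight Ω k j * gbar P.β g₀ j ^ 2 * |Real.log (gbar P.β g₀ j)|) ∧
      |P.linMu g₀ rg rz rμ j| ≤ linMuConst Ω c N C lam * R *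
        (cutoffWeight Ω k j * gbar P.β g₀ j ^ 2 * |Real.log (gbar P.β g₀ j)|)) :=
  ⟨⟨P.linG_zero g₀ rg, P.linG_succ g₀ rg, h.linZ_succ hsmall hR hrg hrz,
    h.linMu_succ hsmall hR hrg hrz hrμ⟩,
    h.tendsto_linZ_linMu_zero hsmall hR hrg hrz hrμ,
    fun j => ⟨h.abs_linG_le hR hrg j, h.abs_linZ_le hsmall hR hrg hrz j,
      h.abs_linMu_le hsmall hR hrg hrz hrμ j⟩⟩

end CutoffQuadHyp


/-! ## The derivative `Dφ̄_j` of the quadratic flow ((4.2)–(4.3)): explicit form, value at `x̊ = V̄`,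
Lipschitz dependence on the base point, and the exact second-order Taylor formula -/

/-- The coordinate projections `p_i : ℝ³ →L ℝ` (with all implicit arguments fixed, for fast
elaboration). [folklore] -/
def prj (i : Fin 3) : V3 →L[ℝ] ℝ := ContinuousLinearMap.proj (R := ℝ) (φ := fun _ : Fin 3 => ℝ) i

/-- `p_i W = W_i`. [folklore] -/
@[simp] theorem prj_apply (i : Fin 3) (W : V3) : prj i W = W i := rfl

/-- The coordinate functions are differentiable with derivative `p_i`. [folklore] -/
theorem hasFDerivAt_coord (i : Fin 3) (V : V3) : HasFDerivAt (fun W : V3 => W i) (prj i) V :=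
  hasFDerivAt_apply (𝕜 := ℝ) (F' := fun _ : Fin 3 => ℝ) i V

namespace QuadFlowParams

variable (P : QuadFlowParams) (j : ℕ)

/-- The rows of `Dφ̄_j(V)` ((4.2)–(4.3)) as linear forms on `ℝ³`: with `p_i` the coordinate projections,
`row₀ = (1-2β_jg)p₀`, `row₁ = -(2θ_jg + ζ_jz)p₀ + (1-ζ_jg)p₁`,
`row₂ = (η_j - 2υ^{gg}g - υ^{gz}z - υ^{gμ}μ)p₀ + (γ_j - υ^{gz}g - 2υ^{zz}z - υ^{zμ}μ)p₁ + (λ_j - υ^{gμ}g - υ^{zμ}z)p₂`.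
[cite: BauerschmidtBrydgesSlade2015Flow, §4.1, (4.2)–(4.3)] -/
def dmapRow (V : V3) : Fin 3 → (V3 →L[ℝ] ℝ) :=
  ![(1 - 2 * P.β j * V 0) • prj 0,
    (-(2 * P.θ j * V 0 + P.ζ j * V 1)) • prj 0 +
      (1 - P.ζ j * V 0) • prj 1,
    (P.η j - 2 * P.υgg j * V 0 - P.υgz j * V 1 - P.υgμ j * V 2) • prj 0 +
      (P.γ j - P.υgz j * V 0 - 2 * P.υzz j * V 1 - P.υzμ j * V 2) • prj 1 +
      (P.lam j - P.υgμ j * V 0 - P.υzμ j * V 1) • prj 2]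

/-- `Dφ̄_j(V) : ℝ³ →L ℝ³`, the Fréchet derivative of the quadratic flow at `V` ((4.2)).
[cite: BauerschmidtBrydgesSlade2015Flow, §4.1, (4.2)] -/
def dmap (V : V3) : V3 →L[ℝ] V3 := ContinuousLinearMap.pi (P.dmapRow j V)

/-- The `g`-row of `Dφ̄_j(V)`: `(1 - 2β_jg) dg`. [cite: BauerschmidtBrydgesSlade2015Flow, §4.1, (4.2)] -/
@[simp] theorem dmap_apply_zero (V dV : V3) : P.dmap j V dV 0 = (1 - 2 * P.β j * V 0) * dV 0 := by
  simp [dmap, dmapRow]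

/-- The `z`-row of `Dφ̄_j(V)`: `-(2θ_jg + ζ_jz) dg + (1 - ζ_jg) dz`. [cite: BauerschmidtBrydgesSlade2015Flow, §4.1, (4.2)–(4.3)] -/
@[simp] theorem dmap_apply_one (V dV : V3) :
    P.dmap j V dV 1 = -(2 * P.θ j * V 0 + P.ζ j * V 1) * dV 0 + (1 - P.ζ j * V 0) * dV 1 := by
  simp [dmap, dmapRow]

/-- The `μ`-row of `Dφ̄_j(V)`: `η̃ dg + γ̃ dz + λ̃ dμ`. [cite: BauerschmidtBrydgesSlade2015Flow, §4.1, (4.2)–(4.3)] -/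
@[simp] theorem dmap_apply_two (V dV : V3) :
    P.dmap j V dV 2 = (P.η j - 2 * P.υgg j * V 0 - P.υgz j * V 1 - P.υgμ j * V 2) * dV 0 +
      (P.γ j - P.υgz j * V 0 - 2 * P.υzz j * V 1 - P.υzμ j * V 2) * dV 1 +
      (P.lam j - P.υgμ j * V 0 - P.υzμ j * V 1) * dV 2 := by
  simp [dmap, dmapRow]

/-- **`φ̄_j` is Fréchet differentiable with derivative `Dφ̄_j(V)`** (everywhere; it is a quadratic
polynomial map). [cite: BauerschmidtBrydgesSlade2015Flow, §4.1, (4.2) ("Explicit computation of the derivative of φ̄_j")] -/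
theorem hasFDerivAt_map (V : V3) : HasFDerivAt (P.map j) (P.dmap j V) V := by
  have hp : ∀ i : Fin 3, HasFDerivAt (fun W : V3 => W i) (prj i) V := fun i => hasFDerivAt_coord i V
  refine hasFDerivAt_pi'' fun i => ?_
  have hrow : (ContinuousLinearMap.proj i).comp (P.dmap j V) = P.dmapRow j V i := by
    simp [dmap]
  rw [hrow]
  fin_cases i
  · -- `g ↦ g - β g²`
    have h0 := hp 0
    have h1 : HasFDerivAt (fun W : V3 => W 0 - P.β j * (W 0 * W 0))
        (prj 0 - P.β j • (V 0 • prj 0 + V 0 • prj 0)) V :=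
      h0.sub ((h0.mul h0).const_smul (P.β j))
    have hfun : (fun W : V3 => P.map j W 0) = fun W : V3 => W 0 - P.β j * (W 0 * W 0) := by
      funext W; simp only [map_apply_zero]; ring
    simp only [Fin.zero_eta, Fin.isValue]
    rw [hfun]
    refine h1.congr_fderiv ?_
    ext dV
    simp [dmapRow]
    ring
  · -- `z ↦ z - (θ g² + ζ g z)`
    have h0 := hp 0; have h1' := hp 1
    have h1 : HasFDerivAt (fun W : V3 => W 1 - (P.θ j * (W 0 * W 0) + P.ζ j * (W 0 * W 1)))
        (prj 1 - (P.θ j • (V 0 • prj 0 + V 0 • prj 0) +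
          P.ζ j • (V 0 • prj 1 + V 1 • prj 0))) V :=
      h1'.sub (((h0.mul h0).const_smul (P.θ j)).add ((h0.mul h1').const_smul (P.ζ j)))
    have hfun : (fun W : V3 => P.map j W 1) = fun W : V3 => W 1 - (P.θ j * (W 0 * W 0) + P.ζ j * (W 0 * W 1)) := by
      funext W; simp only [map_apply_one]; ring
    simp only [Fin.mk_one, Fin.isValue]
    rw [hfun]
    refine h1.congr_fderiv ?_
    ext dV
    simp [dmapRow]
    ring
  · -- `μ ↦ ηg + γz + λμ - (υgg g² + υgz gz + υgμ gμ + υzz z² + υzμ zμ)`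
    have h0 := hp 0; have h1' := hp 1; have h2' := hp 2
    have h1 : HasFDerivAt (fun W : V3 => P.η j * W 0 + P.γ j * W 1 + P.lam j * W 2 -
          (P.υgg j * (W 0 * W 0) + P.υgz j * (W 0 * W 1) + P.υgμ j * (W 0 * W 2) + P.υzz j * (W 1 * W 1) +
            P.υzμ j * (W 1 * W 2)))
        (P.η j • prj 0 + P.γ j • prj 1 + P.lam j • prj 2 -
          (P.υgg j • (V 0 • prj 0 + V 0 • prj 0) +
            P.υgz j • (V 0 • prj 1 + V 1 • prj 0) +
            P.υgμ j • (V 0 • prj 2 + V 2 • prj 0) +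
            P.υzz j • (V 1 • prj 1 + V 1 • prj 1) +
            P.υzμ j • (V 1 • prj 2 + V 2 • prj 1))) V :=
      (((h0.const_smul (P.η j)).add (h1'.const_smul (P.γ j))).add (h2'.const_smul (P.lam j))).sub
        ((((((h0.mul h0).const_smul (P.υgg j)).add ((h0.mul h1').const_smul (P.υgz j))).add
          ((h0.mul h2').const_smul (P.υgμ j))).add ((h1'.mul h1').const_smul (P.υzz j))).add
          ((h1'.mul h2').const_smul (P.υzμ j)))
    have hfun : (fun W : V3 => P.map j W 2) = fun W : V3 => P.η j * W 0 + P.γ j * W 1 + P.lam j * W 2 -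
          (P.υgg j * (W 0 * W 0) + P.υgz j * (W 0 * W 1) + P.υgμ j * (W 0 * W 2) + P.υzz j * (W 1 * W 1) +
            P.υzμ j * (W 1 * W 2)) := by
      funext W; simp only [map_apply_two]; ring
    simp only [Fin.reduceFinMk, Fin.isValue]
    rw [hfun]
    refine h1.congr_fderiv ?_
    ext dV
    simp [dmapRow]
    ring

/-- **`L_j = Dφ̄_j(V̄_j)`** has the entries of (4.3)–(4.4): `a_j = 1 - 2β_jg̊_j`, `-ξ̃_j`, `1 - ζ_jg̊_j`,
`η̃_j`, `γ̃_j`, `λ̃_j`. [cite: BauerschmidtBrydgesSlade2015Flow, §4.1, (4.3)–(4.4)] -/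
theorem dmap_flow_apply (g₀ : ℝ) (dV : V3) :
    P.dmap j (P.flow g₀ j) dV 0 = P.aCoef g₀ j * dV 0 ∧
    P.dmap j (P.flow g₀ j) dV 1 = -P.xiT g₀ j * dV 0 + P.czCoef g₀ j * dV 1 ∧
    P.dmap j (P.flow g₀ j) dV 2 = P.etaT g₀ j * dV 0 + P.gammaT g₀ j * dV 1 + P.lamT g₀ j * dV 2 := by
  refine ⟨?_, ?_, ?_⟩
  · simp [flow, aCoef]
  · simp [flow, xiT, czCoef]
  · simp [flow, etaT, gammaT, lamT]

/-- **`Dφ̄_j` is affine in the base point**: the difference `Dφ̄_j(V') - Dφ̄_j(V)` applied to `dV`,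
row by row ("`D²φ̄_j⁰` is a constant matrix for each `j`", proof of Lemma 4.4).
[cite: BauerschmidtBrydgesSlade2015Flow, Lemma 4.4 (proof, first display and "D²Φ̄_j⁰ is a constant matrix")] -/
theorem dmap_sub_dmap_apply (V V' dV : V3) :
    (P.dmap j V' - P.dmap j V) dV 0 = -(2 * P.β j * (V' 0 - V 0)) * dV 0 ∧
    (P.dmap j V' - P.dmap j V) dV 1 =
      -(2 * P.θ j * (V' 0 - V 0) + P.ζ j * (V' 1 - V 1)) * dV 0 - P.ζ j * (V' 0 - V 0) * dV 1 ∧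
    (P.dmap j V' - P.dmap j V) dV 2 =
      -(2 * P.υgg j * (V' 0 - V 0) + P.υgz j * (V' 1 - V 1) + P.υgμ j * (V' 2 - V 2)) * dV 0 -
        (P.υgz j * (V' 0 - V 0) + 2 * P.υzz j * (V' 1 - V 1) + P.υzμ j * (V' 2 - V 2)) * dV 1 -
        (P.υgμ j * (V' 0 - V 0) + P.υzμ j * (V' 1 - V 1)) * dV 2 := by
  refine ⟨?_, ?_, ?_⟩
  · show (P.dmap j V' dV - P.dmap j V dV) 0 = _
    simp only [Pi.sub_apply, dmap_apply_zero]; ring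
  · show (P.dmap j V' dV - P.dmap j V dV) 1 = _
    simp only [Pi.sub_apply, dmap_apply_one]; ring
  · show (P.dmap j V' dV - P.dmap j V dV) 2 = _
    simp only [Pi.sub_apply, dmap_apply_two]; ring

/-- The sup norm of a vector of `ℝ³` bounds its coordinates. [folklore] -/
theorem abs_apply_le_norm (W : V3) (i : Fin 3) : |W i| ≤ ‖W‖ := by
  rw [← Real.norm_eq_abs]; exact norm_le_pi_norm W i

/-- **Lipschitz bound for `Dφ̄_j` in the base point**: with `M_j = 2|β_j| + 2|θ_j| + 2|ζ_j| + 2|υ^{gg}_j| +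
2|υ^{gz}_j| + 2|υ^{gμ}_j| + 2|υ^{zz}_j| + 2|υ^{zμ}_j|` (`= O(χ_j)` under (A1)–(A2)),
`‖Dφ̄_j(V') - Dφ̄_j(V)‖ ≤ M_j ‖V' - V‖` (sup norms on `ℝ³`, operator norm).
[cite: BauerschmidtBrydgesSlade2015Flow, Lemma 4.4 (proof: "D²Φ̄⁰_j is a constant matrix with coefficients bounded by O(χ_j)")] -/
theorem norm_dmap_sub_dmap_le (V V' : V3) :
    ‖P.dmap j V' - P.dmap j V‖ ≤
      (2 * |P.β j| + 2 * |P.θ j| + 2 * |P.ζ j| + 2 * |P.υgg j| + 2 * |P.υgz j| + 2 * |P.υgμ j| +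
        2 * |P.υzz j| + 2 * |P.υzμ j|) * ‖V' - V‖ := by
  set M := 2 * |P.β j| + 2 * |P.θ j| + 2 * |P.ζ j| + 2 * |P.υgg j| + 2 * |P.υgz j| + 2 * |P.υgμ j| +
    2 * |P.υzz j| + 2 * |P.υzμ j| with hM
  have hM0 : 0 ≤ M := by positivity
  have hall : 0 ≤ |P.β j| ∧ 0 ≤ |P.θ j| ∧ 0 ≤ |P.ζ j| ∧ 0 ≤ |P.υgg j| ∧ 0 ≤ |P.υgz j| ∧ 0 ≤ |P.υgμ j| ∧
      0 ≤ |P.υzz j| ∧ 0 ≤ |P.υzμ j| :=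
    ⟨abs_nonneg _, abs_nonneg _, abs_nonneg _, abs_nonneg _, abs_nonneg _, abs_nonneg _, abs_nonneg _,
      abs_nonneg _⟩
  refine ContinuousLinearMap.opNorm_le_bound _ (by positivity) fun dV => ?_
  obtain ⟨e0, e1, e2⟩ := P.dmap_sub_dmap_apply j V V' dV
  set Δ := V' - V with hΔ
  have hΔi : ∀ i, |V' i - V i| ≤ ‖Δ‖ := fun i => by
    have := abs_apply_le_norm Δ i; simpa [hΔ] using this
  have hdVi : ∀ i, |dV i| ≤ ‖dV‖ := abs_apply_le_norm dV
  -- each coordinate of the image is bounded by `M ‖Δ‖ ‖dV‖`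
  refine (pi_norm_le_iff_of_nonneg (by positivity)).2 fun i => ?_
  rw [Real.norm_eq_abs]
  have hΔ0 := norm_nonneg Δ; have hdV0 := norm_nonneg dV
  have b0 := hΔi 0; have b1 := hΔi 1; have b2 := hΔi 2
  have d0 := hdVi 0; have d1 := hdVi 1; have d2 := hdVi 2
  have habs : ∀ x y : ℝ, |x * y| = |x| * |y| := fun x y => abs_mul x y
  fin_cases i
  · simp only [Fin.zero_eta, Fin.isValue]
    rw [e0, abs_mul, abs_neg, abs_mul, abs_mul, abs_two]
    calc 2 * |P.β j| * |V' 0 - V 0| * |dV 0| ≤ 2 * |P.β j| * ‖Δ‖ * ‖dV‖ := by gcongr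
      _ ≤ M * ‖Δ‖ * ‖dV‖ := by
          have : 2 * |P.β j| ≤ M := by rw [hM]; linarith [hall]
          gcongr
      _ = M * ‖V' - V‖ * ‖dV‖ := by rw [hΔ]
  · simp only [Fin.mk_one, Fin.isValue]
    rw [e1]
    calc |-(2 * P.θ j * (V' 0 - V 0) + P.ζ j * (V' 1 - V 1)) * dV 0 - P.ζ j * (V' 0 - V 0) * dV 1|
        ≤ (2 * |P.θ j| * |V' 0 - V 0| + |P.ζ j| * |V' 1 - V 1|) * |dV 0| + |P.ζ j| * |V' 0 - V 0| * |dV 1| := by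
          refine (abs_sub _ _).trans (add_le_add ?_ (le_of_eq ?_))
          · rw [abs_mul, abs_neg]
            refine mul_le_mul_of_nonneg_right ((abs_add_le _ _).trans (le_of_eq ?_)) (abs_nonneg _)
            rw [abs_mul, abs_mul, abs_two, abs_mul]
          · rw [abs_mul, abs_mul]
      _ ≤ (2 * |P.θ j| * ‖Δ‖ + |P.ζ j| * ‖Δ‖) * ‖dV‖ + |P.ζ j| * ‖Δ‖ * ‖dV‖ := by gcongr
      _ = (2 * |P.θ j| + 2 * |P.ζ j|) * ‖Δ‖ * ‖dV‖ := by ring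
      _ ≤ M * ‖Δ‖ * ‖dV‖ := by
          have : 2 * |P.θ j| + 2 * |P.ζ j| ≤ M := by rw [hM]; linarith [hall]
          gcongr
      _ = M * ‖V' - V‖ * ‖dV‖ := by rw [hΔ]
  · simp only [Fin.reduceFinMk, Fin.isValue]
    rw [e2]
    calc |-(2 * P.υgg j * (V' 0 - V 0) + P.υgz j * (V' 1 - V 1) + P.υgμ j * (V' 2 - V 2)) * dV 0 -
            (P.υgz j * (V' 0 - V 0) + 2 * P.υzz j * (V' 1 - V 1) + P.υzμ j * (V' 2 - V 2)) * dV 1 -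
            (P.υgμ j * (V' 0 - V 0) + P.υzμ j * (V' 1 - V 1)) * dV 2|
        ≤ (2 * |P.υgg j| * |V' 0 - V 0| + |P.υgz j| * |V' 1 - V 1| + |P.υgμ j| * |V' 2 - V 2|) * |dV 0| +
            (|P.υgz j| * |V' 0 - V 0| + 2 * |P.υzz j| * |V' 1 - V 1| + |P.υzμ j| * |V' 2 - V 2|) * |dV 1| +
            (|P.υgμ j| * |V' 0 - V 0| + |P.υzμ j| * |V' 1 - V 1|) * |dV 2| := by
          refine (abs_sub _ _).trans (add_le_add ((abs_sub _ _).trans (add_le_add ?_ ?_)) ?_)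
          · rw [abs_mul, abs_neg]
            refine mul_le_mul_of_nonneg_right ((abs_add_le _ _).trans (add_le_add ((abs_add_le _ _).trans
              (le_of_eq ?_)) (le_of_eq (abs_mul _ _)))) (abs_nonneg _)
            rw [abs_mul, abs_mul, abs_two, abs_mul]
          · rw [abs_mul]
            refine mul_le_mul_of_nonneg_right ((abs_add_le _ _).trans (add_le_add ((abs_add_le _ _).trans
              (le_of_eq ?_)) (le_of_eq (abs_mul _ _)))) (abs_nonneg _)
            rw [abs_mul, abs_mul, abs_mul, abs_two]
          · rw [abs_mul]
            refine mul_le_mul_of_nonneg_right ((abs_add_le _ _).trans (le_of_eq ?_)) (abs_nonneg _)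
            rw [abs_mul, abs_mul]
      _ ≤ (2 * |P.υgg j| * ‖Δ‖ + |P.υgz j| * ‖Δ‖ + |P.υgμ j| * ‖Δ‖) * ‖dV‖ +
            (|P.υgz j| * ‖Δ‖ + 2 * |P.υzz j| * ‖Δ‖ + |P.υzμ j| * ‖Δ‖) * ‖dV‖ +
            (|P.υgμ j| * ‖Δ‖ + |P.υzμ j| * ‖Δ‖) * ‖dV‖ := by gcongr
      _ = (2 * |P.υgg j| + 2 * |P.υgz j| + 2 * |P.υgμ j| + 2 * |P.υzz j| + 2 * |P.υzμ j|) * ‖Δ‖ * ‖dV‖ := by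
          ring
      _ ≤ M * ‖Δ‖ * ‖dV‖ := by
          have : 2 * |P.υgg j| + 2 * |P.υgz j| + 2 * |P.υgμ j| + 2 * |P.υzz j| + 2 * |P.υzμ j| ≤ M := by
            rw [hM]; linarith [hall]
          gcongr
      _ = M * ‖V' - V‖ * ‖dV‖ := by rw [hΔ]

/-- **Exact second-order Taylor formula** (the map is quadratic): `φ̄_j(V + dV) - φ̄_j(V) - Dφ̄_j(V)dV`
is the quadratic form `-(β dg², θ dg² + ζ dg dz, υ^{gg}dg² + υ^{gz}dg dz + υ^{gμ}dg dμ + υ^{zz}dz² + υ^{zμ}dz dμ)`.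
[cite: BauerschmidtBrydgesSlade2015Flow, §1.1, (1.1)–(1.3) and Lemma 4.4] -/
theorem map_add_sub_sub_dmap (V dV : V3) :
    P.map j (V + dV) - P.map j V - P.dmap j V dV =
      ![-(P.β j * dV 0 ^ 2),
        -(P.θ j * dV 0 ^ 2 + P.ζ j * dV 0 * dV 1),
        -(P.υgg j * dV 0 ^ 2 + P.υgz j * dV 0 * dV 1 + P.υgμ j * dV 0 * dV 2 + P.υzz j * dV 1 ^ 2 +
          P.υzμ j * dV 1 * dV 2)] := by
  ext i
  fin_cases i
  · simp [map]; ring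
  · simp [map]; ring
  · simp [map]; ring

/-- The quadratic remainder is bounded by `(|β_j| + |θ_j| + |ζ_j| + Σ|υ_j|)‖dV‖²`.
[cite: BauerschmidtBrydgesSlade2015Flow, Lemma 3.3, (3.10) (the φ̄-part has an exact quadratic remainder)] -/
theorem norm_map_add_sub_sub_dmap_le (V dV : V3) :
    ‖P.map j (V + dV) - P.map j V - P.dmap j V dV‖ ≤
      (|P.β j| + |P.θ j| + |P.ζ j| + |P.υgg j| + |P.υgz j| + |P.υgμ j| + |P.υzz j| + |P.υzμ j|) * ‖dV‖ ^ 2 := by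
  rw [P.map_add_sub_sub_dmap]
  have hd : ∀ i, |dV i| ≤ ‖dV‖ := abs_apply_le_norm dV
  have d0 := hd 0; have d1 := hd 1; have d2 := hd 2
  have hn := norm_nonneg dV
  have hprod : ∀ i i', |dV i * dV i'| ≤ ‖dV‖ ^ 2 := fun i i' => by
    rw [abs_mul, sq]; exact mul_le_mul (hd i) (hd i') (abs_nonneg _) hn
  have hsq : ∀ i, |dV i ^ 2| ≤ ‖dV‖ ^ 2 := fun i => by rw [sq, sq]; exact (sq (‖dV‖)) ▸ (sq (‖dV‖)).symm ▸ hprod i i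
  set S := |P.β j| + |P.θ j| + |P.ζ j| + |P.υgg j| + |P.υgz j| + |P.υgμ j| + |P.υzz j| + |P.υzμ j| with hS
  have hall : 0 ≤ |P.β j| ∧ 0 ≤ |P.θ j| ∧ 0 ≤ |P.ζ j| ∧ 0 ≤ |P.υgg j| ∧ 0 ≤ |P.υgz j| ∧ 0 ≤ |P.υgμ j| ∧
      0 ≤ |P.υzz j| ∧ 0 ≤ |P.υzμ j| :=
    ⟨abs_nonneg _, abs_nonneg _, abs_nonneg _, abs_nonneg _, abs_nonneg _, abs_nonneg _, abs_nonneg _,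
      abs_nonneg _⟩
  refine (pi_norm_le_iff_of_nonneg (by positivity)).2 fun i => ?_
  rw [Real.norm_eq_abs]
  fin_cases i
  · simp only [Fin.zero_eta, Fin.isValue, Matrix.cons_val_zero, abs_neg]
    rw [abs_mul]
    calc |P.β j| * |dV 0 ^ 2| ≤ |P.β j| * ‖dV‖ ^ 2 := mul_le_mul_of_nonneg_left (hsq 0) (abs_nonneg _)
      _ ≤ S * ‖dV‖ ^ 2 := by gcongr; rw [hS]; linarith [hall]
  · simp only [Fin.mk_one, Fin.isValue, Matrix.cons_val_one, Matrix.cons_val_zero, abs_neg]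
    calc |P.θ j * dV 0 ^ 2 + P.ζ j * dV 0 * dV 1| ≤ |P.θ j| * |dV 0 ^ 2| + |P.ζ j| * |dV 0 * dV 1| := by
          refine (abs_add_le _ _).trans (le_of_eq ?_); rw [abs_mul, mul_assoc, abs_mul]
      _ ≤ |P.θ j| * ‖dV‖ ^ 2 + |P.ζ j| * ‖dV‖ ^ 2 :=
          add_le_add (mul_le_mul_of_nonneg_left (hsq 0) (abs_nonneg _))
            (mul_le_mul_of_nonneg_left (hprod 0 1) (abs_nonneg _))
      _ = (|P.θ j| + |P.ζ j|) * ‖dV‖ ^ 2 := by ring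
      _ ≤ S * ‖dV‖ ^ 2 := by gcongr; rw [hS]; linarith [hall]
  · simp only [Fin.reduceFinMk, Fin.isValue, Matrix.cons_val, abs_neg]
    calc |P.υgg j * dV 0 ^ 2 + P.υgz j * dV 0 * dV 1 + P.υgμ j * dV 0 * dV 2 + P.υzz j * dV 1 ^ 2 +
            P.υzμ j * dV 1 * dV 2|
        ≤ |P.υgg j| * |dV 0 ^ 2| + |P.υgz j| * |dV 0 * dV 1| + |P.υgμ j| * |dV 0 * dV 2| +
            |P.υzz j| * |dV 1 ^ 2| + |P.υzμ j| * |dV 1 * dV 2| := by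
          refine (abs_add_le _ _).trans (add_le_add ((abs_add_le _ _).trans (add_le_add ((abs_add_le _ _).trans
            (add_le_add ((abs_add_le _ _).trans (add_le_add (le_of_eq (abs_mul _ _)) (le_of_eq ?_)))
              (le_of_eq ?_))) (le_of_eq (abs_mul _ _)))) (le_of_eq ?_))
          · rw [mul_assoc, abs_mul]
          · rw [mul_assoc, abs_mul]
          · rw [mul_assoc, abs_mul]
      _ ≤ |P.υgg j| * ‖dV‖ ^ 2 + |P.υgz j| * ‖dV‖ ^ 2 + |P.υgμ j| * ‖dV‖ ^ 2 + |P.υzz j| * ‖dV‖ ^ 2 +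
            |P.υzμ j| * ‖dV‖ ^ 2 := by
          gcongr
          · exact hsq 0
          · exact hprod 0 1
          · exact hprod 0 2
          · exact hsq 1
          · exact hprod 1 2
      _ = (|P.υgg j| + |P.υgz j| + |P.υgμ j| + |P.υzz j| + |P.υzμ j|) * ‖dV‖ ^ 2 := by ring
      _ ≤ S * ‖dV‖ ^ 2 := by gcongr; rw [hS]; linarith [hall]

end QuadFlowParams


end CTWSAW

end Literature.Barriers.CriticalPhenomena
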